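import Literature.Analysis.FluidPDE.Tao2016AveragedNS.DelayCircuit
import Literature.Analysis.FluidPDE.Tao2016AveragedNS.GlobalWellposedness
import HarnessLib

/-!
# Tao 2016, Theorem 5.3 (delayed abrupt energy transition) — proof

T. Tao, *Finite time blowup for an averaged three-dimensional Navier–Stokes equation*, J. Amer.
Math. Soc. **29** (2016) 601–674 = arXiv:1402.0290, §5.5, Theorem 5.3 and its proof (pp. 28–30 of
the arXiv version). [`Tao2016AveragedNS`]

HONEST FRAMING (cell pub-fluidc): part of a low prior, high value-of-information experiment on
Tao's machine paradigm; NOT a claim that NS blows up. This file discharges the named fact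
`DelayedAbruptTransition` of `DelayCircuit.lean` (Theorem 5.3, typed there verbatim) by following
the printed bootstrap proof.

## Architecture of the printed proof (pp. 28–30) and where each step is below
Modes `(a,b,c,d,ã) = (X 0, X 1, X 2, X 3, X 4)`; couplings `μ = ε²e^{-K¹⁰}` (tiny pump `a → c`),
`ν = ε⁻¹K¹⁰` (amplifier `b ⇒ c`), `ρ = ε⁻²` (rotor), `K` (drain `d → ã`), `k = K¹⁰`. All helper
lemmas live in the sub-namespace `Thm53`; only `DelayedAbruptTransition_holds` is exported.
* (energy-con), (est): `a²+b²+c²+d²+ã² = 1`, all modes `O(1)` — `DelayCircuit.delayCircuit_energy`,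
  here `Thm53.traj_sum_sq_eq_one`, `Thm53.traj_abs_le_one`.
* (ob-2) `b, c = O(ε)` on `[0,2]` from `∂ₜ(b²+c²) = 2εa²b + 2μa²c` via `√(b²+c²+ε²)` — `bc_small`.
* `c ≥ 0` (comparison, integrating factor `exp(-∫νb)`) — `c_nonneg`; (code) crude Grönwall
  `c ≤ 2ε² e^{(5t-1)k}` — `c_crude`.
* the continuity ("bootstrap") device: `t_c :=` first time in `[0,2]` at which `c` reaches
  `K⁻¹⁰ε²`, so that (boots) `c ≤ K⁻¹⁰ε²` on `[0,t_c]` and `c(t_c) = K⁻¹⁰ε²` if `t_c < 2` —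
  `exists_hitTime`.
* (dora) `d, ã = O(K⁻¹⁰)` on `[0,t_c]` — `de_small`; (able2) `a = 1 + O(K⁻²⁰)` — `a_near_one`;
  (bogo-2) `b = εt + O(K⁻²⁰ε)` — `b_linear`.
* sharp two-sided comparison for `c` on `[0,t_c]` with integrating factors `exp(-(kt²/2 ± βt))`
  (Tao integrates exactly and quotes error-function asymptotics; explicit super- and sub-solutions
  give the same window) — `c_upper_sharp`, `c_lower_sharp`; whence (tcable)
  `√2 - 1/√K ≤ t_c ≤ √2 + 1/√K` and (c-bound) `c(t_c) = K⁻¹⁰ε²` — `tc_window`.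
* after `t_c`: `b ≳ ε` — `b_lower_after`; exponential growth — `c_growth`; (c-large)
  `c ≥ K¹⁰⁰ε²` on `I = [t_c + K⁻⁹, 2]` — `c_large`; (cgrow-2) `0 ≤ ∂ₜc ≤ 6K¹⁰c` — `c_deriv_bounds`.
* equipartition: `V = ad·ε²/c` has `∂ₜV = (a²-d²) + R`, `|R| ≤ 9K⁻⁹⁰` (douse) — `hasDerivAt_V`,
  `V_remainder_le`; claim (atc) `ã(t_c + 1/K) ≥ 1/10` — `e_tenth`; modified energy
  `E_* = ½(1-ã²) - ½K·V·ã` (`= ½(a²+b²+c²+d²) - ½K·V·ã` by (energy-con)) — `hasDerivAt_Es`,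
  `∂ₜE_* + Kã(t')E_* ≤ 7K⁻⁸⁹` — `Es_alg`, `Es_dissipation`; Grönwall (toke) — `Es_decay`;
  (beable) — `ad_small_late`, `late_sum_sq`, `beable_of_sum_sq`; (able2) — `able_window`;
  thresholds — `numeric_N3`, `numeric_N4`, `eps_facts`; assembly — `DelayedAbruptTransition_holds`;
  for THE trajectory `delaySolution K ε` of `GlobalWellposedness.lean` — `delaySolution_hasAbruptTransition`,
  and the internal time-scales (trigger level, rotor onset `t_c + K⁻⁹`, `ã(t_c + 1/K) ≥ 1/10`,
  residual `≤ 143K⁻²⁰` from `t_c + 1/√K`) — `delaySolution_internal_timescales`.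
  (Sign of the corrector: p. 29 prints `∂ₜ(ad) = ε⁻²c(a²-d²) - O(K)` and then (douse) with the
  opposite leading sign; with `(ad)' = +ε⁻²c(a²-d²) + O(K)` the corrector must enter `E_*` with a
  minus sign for (E*-decay) `∂ₜE_* = -Kã E_* + O(K⁻⁸⁰)` to hold, which is what is done here; the
  rest of the printed argument is unchanged.)
Constants: the implied absolute constant is `C = 200`; `K ≥ K₀ := 8¹¹¹·111! + 2·20⁴²·42! + 16`
(so that `e^{K/8} ≥ K¹¹⁰` and `e^{(√K-1)/10} ≥ 2K²⁰`; `e^{K⁹} > 2eK¹⁰` needs only `K ≥ 2`);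
`ε ≤ ε₁(K) := e^{-10K¹⁰}/K¹⁰⁰`. No attempt is made to optimise them (the source does not).

## References
* T. Tao, JAMS 29 (2016) 601–674, arXiv:1402.0290, §5.5 Theorem 5.3 and proof. [`Tao2016AveragedNS`]
-/

noncomputable section

namespace Literature.Analysis.FluidPDE.Tao2016AveragedNS

open Set Real Filter
open _root_.Topology

namespace Thm53

/-! ## Toolkit 1: monotonicity from one-sided derivative bounds (integrating factors) -/

/-- Integrating-factor comparison, upper form: if `(f' - g f)e^{-G} ≤ φ` on a convex set `s`
(`G' = g`, `Φ' = φ`) then `t ↦ f(t)e^{-G(t)} - Φ(t)` is antitone on `s`. [folklore] -/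
theorem antitoneOn_intFactor {f f' g G φ Φ : ℝ → ℝ} {s : Set ℝ} (hs : Convex ℝ s)
    (hf : ∀ t ∈ s, HasDerivAt f (f' t) t) (hG : ∀ t ∈ s, HasDerivAt G (g t) t)
    (hΦ : ∀ t ∈ s, HasDerivAt Φ (φ t) t)
    (h : ∀ t ∈ s, (f' t - g t * f t) * exp (-G t) ≤ φ t) :
    AntitoneOn (fun t => f t * exp (-G t) - Φ t) s := by
  have hd : ∀ t ∈ s, HasDerivAt (fun t => f t * exp (-G t) - Φ t)
      ((f' t - g t * f t) * exp (-G t) - φ t) t := by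
    intro t ht
    refine (((hf t ht).fun_mul (hG t ht).fun_neg.exp).fun_sub (hΦ t ht)).congr_deriv ?_
    ring
  refine antitoneOn_of_hasDerivWithinAt_nonpos hs
    (fun t ht => (hd t ht).continuousAt.continuousWithinAt)
    (fun t ht => (hd t (interior_subset ht)).hasDerivWithinAt) ?_
  intro t ht
  exact sub_nonpos.2 (h t (interior_subset ht))

/-- Integrating-factor comparison, lower form: if `φ ≤ (f' - g f)e^{-G}` on a convex set `s`
(`G' = g`, `Φ' = φ`) then `t ↦ f(t)e^{-G(t)} - Φ(t)` is monotone on `s`. [folklore] -/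
theorem monotoneOn_intFactor {f f' g G φ Φ : ℝ → ℝ} {s : Set ℝ} (hs : Convex ℝ s)
    (hf : ∀ t ∈ s, HasDerivAt f (f' t) t) (hG : ∀ t ∈ s, HasDerivAt G (g t) t)
    (hΦ : ∀ t ∈ s, HasDerivAt Φ (φ t) t)
    (h : ∀ t ∈ s, φ t ≤ (f' t - g t * f t) * exp (-G t)) :
    MonotoneOn (fun t => f t * exp (-G t) - Φ t) s := by
  have hd : ∀ t ∈ s, HasDerivAt (fun t => f t * exp (-G t) - Φ t)
      ((f' t - g t * f t) * exp (-G t) - φ t) t := by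
    intro t ht
    refine (((hf t ht).fun_mul (hG t ht).fun_neg.exp).fun_sub (hΦ t ht)).congr_deriv ?_
    ring
  refine monotoneOn_of_hasDerivWithinAt_nonneg hs
    (fun t ht => (hd t ht).continuousAt.continuousWithinAt)
    (fun t ht => (hd t (interior_subset ht)).hasDerivWithinAt) ?_
  intro t ht
  exact sub_nonneg.2 (h t (interior_subset ht))

/-- Upper derivative bound: `f' ≤ φ = Φ'` on a convex set ⇒ `f - Φ` antitone. [folklore] -/
theorem antitoneOn_sub_of_deriv_le {f f' φ Φ : ℝ → ℝ} {s : Set ℝ} (hs : Convex ℝ s)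
    (hf : ∀ t ∈ s, HasDerivAt f (f' t) t) (hΦ : ∀ t ∈ s, HasDerivAt Φ (φ t) t)
    (h : ∀ t ∈ s, f' t ≤ φ t) : AntitoneOn (fun t => f t - Φ t) s := by
  have := antitoneOn_intFactor (g := fun _ => 0) (G := fun _ => 0) hs hf
    (fun t _ => hasDerivAt_const t (0 : ℝ)) hΦ (fun t ht => by simpa using h t ht)
  simpa using this

/-- Lower derivative bound: `Φ' = φ ≤ f'` on a convex set ⇒ `f - Φ` monotone. [folklore] -/
theorem monotoneOn_sub_of_le_deriv {f f' φ Φ : ℝ → ℝ} {s : Set ℝ} (hs : Convex ℝ s)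
    (hf : ∀ t ∈ s, HasDerivAt f (f' t) t) (hΦ : ∀ t ∈ s, HasDerivAt Φ (φ t) t)
    (h : ∀ t ∈ s, φ t ≤ f' t) : MonotoneOn (fun t => f t - Φ t) s := by
  have := monotoneOn_intFactor (g := fun _ => 0) (G := fun _ => 0) hs hf
    (fun t _ => hasDerivAt_const t (0 : ℝ)) hΦ (fun t ht => by simpa using h t ht)
  simpa using this

/-! ## Toolkit 2: the first hitting time of a level (continuity / bootstrap arguments) -/

/-- **First hitting time.** For continuous `u` with `u 0 < θ` and `T > 0` there is `τ ∈ (0,T]`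
with `u ≤ θ` on `[0,τ]` and `u τ = θ` unless `τ = T` (namely
`τ = inf ({t ∈ [0,T] : θ ≤ u t} ∪ {T})`). This is the "continuity argument" device of the
bootstrap. [folklore] -/
theorem exists_hitTime {u : ℝ → ℝ} (hu : Continuous u) {θ T : ℝ} (hT : 0 < T) (h0 : u 0 < θ) :
    ∃ τ : ℝ, 0 < τ ∧ τ ≤ T ∧ (∀ t, 0 ≤ t → t ≤ τ → u t ≤ θ) ∧ (τ < T → u τ = θ) := by
  set S : Set ℝ := {t | t ∈ Icc 0 T ∧ θ ≤ u t} ∪ {T} with hS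
  have hbdd : BddBelow S := by
    refine ⟨0, fun t ht => ?_⟩
    rcases ht with ht | ht
    · exact ht.1.1
    · rw [mem_singleton_iff] at ht; rw [ht]; exact hT.le
  have hne : S.Nonempty := ⟨T, Or.inr rfl⟩
  have hclosed : IsClosed S :=
    (isClosed_Icc.inter (isClosed_le continuous_const hu)).union isClosed_singleton
  set τ := sInf S with hτ
  have hτT : τ ≤ T := csInf_le hbdd (Or.inr rfl)
  have hτ0 : 0 ≤ τ := by
    refine le_csInf hne fun t ht => ?_
    rcases ht with ht | ht
    · exact ht.1.1
    · rw [mem_singleton_iff] at ht; rw [ht]; exact hT.le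
  -- before `τ` the level is not reached
  have hlt : ∀ t, 0 ≤ t → t < τ → u t < θ := by
    intro t ht0 ht
    by_contra h
    have : τ ≤ t := csInf_le hbdd (Or.inl ⟨⟨ht0, ht.le.trans hτT⟩, not_lt.1 h⟩)
    exact absurd ht (not_lt.2 this)
  -- at `τ` (if `τ < T`) the level is reached
  have hmem : τ ∈ S := hclosed.csInf_mem hne hbdd
  have hge : τ < T → θ ≤ u τ := by
    intro h
    rcases hmem with hm | hm
    · exact hm.2
    · exact absurd (mem_singleton_iff.1 hm) h.ne
  -- `τ > 0`
  have hτpos : 0 < τ := by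
    rcases hτ0.lt_or_eq with h | h
    · exact h
    · exfalso
      have := hge (by rw [← h]; exact hT)
      rw [← h] at this
      exact absurd h0 (not_lt.2 this)
  -- `u τ ≤ θ` by continuity from the left
  have hle : u τ ≤ θ := by
    have hev : ∀ᶠ s in 𝓝[<] τ, u s ≤ θ := by
      filter_upwards [Ioo_mem_nhdsLT hτpos] with s hs
      exact (hlt s hs.1.le hs.2).le
    exact le_of_tendsto (hu.continuousAt.continuousWithinAt.tendsto) hev
  refine ⟨τ, hτpos, hτT, fun t ht0 ht => ?_, fun h => le_antisymm hle (hge h)⟩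
  rcases ht.lt_or_eq with h | h
  · exact (hlt t ht0 h).le
  · rw [h]; exact hle

/-! ## The trajectory: components, energy, signs -/

section Trajectory

variable {K ε : ℝ} {X : ℝ → Fin 5 → ℝ}

/-- Each mode of a trajectory is continuous. [folklore] -/
theorem continuous_traj (hX : ∀ t, HasDerivAt X (delayCircuit K ε (X t)) t) (i : Fin 5) :
    Continuous fun s => X s i :=
  (continuous_apply i).comp (continuous_iff_continuousAt.2 fun t => (hX t).continuousAt)

/-- (a-eq): `∂ₜa = -ε⁻²cd - εab - ε²e^{-K¹⁰}ac`. [cite: Tao2016AveragedNS, §5.5 (5.5)] -/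
theorem hasDerivAt_a (hX : ∀ t, HasDerivAt X (delayCircuit K ε (X t)) t) (t : ℝ) :
    HasDerivAt (fun s => X s 0)
      (-((ε ^ 2)⁻¹ * X t 2 * X t 3) - ε * X t 0 * X t 1
        - ε ^ 2 * exp (-K ^ 10) * X t 0 * X t 2) t :=
  (hasDerivAt_pi.1 (hX t) 0).congr_deriv (by simp [delayCircuit])

/-- (b-eq): `∂ₜb = εa² - ε⁻¹K¹⁰c²`. [cite: Tao2016AveragedNS, §5.5 (5.5)] -/
theorem hasDerivAt_b (hX : ∀ t, HasDerivAt X (delayCircuit K ε (X t)) t) (t : ℝ) :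
    HasDerivAt (fun s => X s 1) (ε * X t 0 ^ 2 - ε⁻¹ * K ^ 10 * X t 2 ^ 2) t :=
  (hasDerivAt_pi.1 (hX t) 1).congr_deriv (by simp [delayCircuit])

/-- (c-eq): `∂ₜc = ε²e^{-K¹⁰}a² + ε⁻¹K¹⁰bc`. [cite: Tao2016AveragedNS, §5.5 (5.5)] -/
theorem hasDerivAt_c (hX : ∀ t, HasDerivAt X (delayCircuit K ε (X t)) t) (t : ℝ) :
    HasDerivAt (fun s => X s 2)
      (ε ^ 2 * exp (-K ^ 10) * X t 0 ^ 2 + ε⁻¹ * K ^ 10 * X t 1 * X t 2) t :=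
  (hasDerivAt_pi.1 (hX t) 2).congr_deriv (by simp [delayCircuit])

/-- (d-eq): `∂ₜd = ε⁻²ca - Kdã`. [cite: Tao2016AveragedNS, §5.5 (5.5)] -/
theorem hasDerivAt_d (hX : ∀ t, HasDerivAt X (delayCircuit K ε (X t)) t) (t : ℝ) :
    HasDerivAt (fun s => X s 3) ((ε ^ 2)⁻¹ * X t 2 * X t 0 - K * X t 3 * X t 4) t :=
  (hasDerivAt_pi.1 (hX t) 3).congr_deriv (by simp [delayCircuit])

/-- (ta-eq): `∂ₜã = Kd²`. [cite: Tao2016AveragedNS, §5.5 (5.5)] -/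
theorem hasDerivAt_e (hX : ∀ t, HasDerivAt X (delayCircuit K ε (X t)) t) (t : ℝ) :
    HasDerivAt (fun s => X s 4) (K * X t 3 ^ 2) t :=
  (hasDerivAt_pi.1 (hX t) 4).congr_deriv (by simp [delayCircuit])

/-- (energy-con) in components. [cite: Tao2016AveragedNS, §5.5 (energy-con)] -/
theorem traj_sum_sq_eq_one (hX : ∀ t, HasDerivAt X (delayCircuit K ε (X t)) t)
    (h0 : X 0 = delayInit) (t : ℝ) :
    X t 0 ^ 2 + X t 1 ^ 2 + X t 2 ^ 2 + X t 3 ^ 2 + X t 4 ^ 2 = 1 := by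
  have h := delayCircuit_energy hX h0 t
  simpa [energy, Fin.sum_univ_five] using h

/-- (est): every mode is `O(1)`. [cite: Tao2016AveragedNS, §5.5 (est)] -/
theorem traj_sq_le_one (hX : ∀ t, HasDerivAt X (delayCircuit K ε (X t)) t)
    (h0 : X 0 = delayInit) (t : ℝ) (i : Fin 5) : X t i ^ 2 ≤ 1 := by
  have h := delayCircuit_energy hX h0 t
  rw [energy] at h
  calc X t i ^ 2 ≤ ∑ j, X t j ^ 2 :=
        Finset.single_le_sum (f := fun j => X t j ^ 2) (fun j _ => sq_nonneg (X t j))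
          (Finset.mem_univ i)
    _ = 1 := h

/-- (est): `|Xᵢ| ≤ 1`. [cite: Tao2016AveragedNS, §5.5 (est)] -/
theorem traj_abs_le_one (hX : ∀ t, HasDerivAt X (delayCircuit K ε (X t)) t)
    (h0 : X 0 = delayInit) (t : ℝ) (i : Fin 5) : |X t i| ≤ 1 :=
  sq_le_one_iff_abs_le_one _ |>.1 (traj_sq_le_one hX h0 t i)

/-- (a-init): `a(0) = 1`. [cite: Tao2016AveragedNS, §5.5 (5.6)] -/
theorem init_a (h0 : X 0 = delayInit) : X 0 0 = 1 := by simp [h0, delayInit]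
/-- (a-init): `b(0) = 0`. [cite: Tao2016AveragedNS, §5.5 (5.6)] -/
theorem init_b (h0 : X 0 = delayInit) : X 0 1 = 0 := by simp [h0, delayInit]
/-- (a-init): `c(0) = 0`. [cite: Tao2016AveragedNS, §5.5 (5.6)] -/
theorem init_c (h0 : X 0 = delayInit) : X 0 2 = 0 := by simp [h0, delayInit]
/-- (a-init): `d(0) = 0`. [cite: Tao2016AveragedNS, §5.5 (5.6)] -/
theorem init_d (h0 : X 0 = delayInit) : X 0 3 = 0 := by simp [h0, delayInit]
/-- (a-init): `ã(0) = 0`. [cite: Tao2016AveragedNS, §5.5 (5.6)] -/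
theorem init_e (h0 : X 0 = delayInit) : X 0 4 = 0 := by simp [h0, delayInit]

/-- `ã ≥ 0` for `t ≥ 0` (it is non-decreasing from `0`). [cite: Tao2016AveragedNS, §5.5 proof] -/
theorem e_nonneg (hX : ∀ t, HasDerivAt X (delayCircuit K ε (X t)) t) (h0 : X 0 = delayInit)
    (hK : 0 ≤ K) {t : ℝ} (ht : 0 ≤ t) : 0 ≤ X t 4 := by
  have := delayCircuit_output_monotone hK hX ht
  simpa [init_e h0] using this

/-! ## (ob-2): `b, c = O(ε)` on `[0,2]` -/

/-- (ob-2), quantitatively: `|b|, |c| ≤ 5ε` on `[0,2]`, from the local energy identity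
`∂ₜ(b²+c²) = 2εa²b + 2μa²c` applied to `√(b²+c²+ε²)`. [cite: Tao2016AveragedNS, §5.5 (ob-2)] -/
theorem bc_small (hX : ∀ t, HasDerivAt X (delayCircuit K ε (X t)) t) (h0 : X 0 = delayInit)
    (hε : 0 < ε) (hε1 : ε ≤ 1) {t : ℝ} (ht : t ∈ Icc 0 2) :
    |X t 1| ≤ 5 * ε ∧ |X t 2| ≤ 5 * ε := by
  set f : ℝ → ℝ := fun s => X s 1 ^ 2 + X s 2 ^ 2 with hf
  set h : ℝ → ℝ := fun s => sqrt (f s + ε ^ 2) with hh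
  have hfpos : ∀ s, 0 < f s + ε ^ 2 := fun s => by positivity
  have hb_le : ∀ s, |X s 1| ≤ h s := fun s =>
    abs_le_sqrt (by simp only [hf]; nlinarith [sq_nonneg (X s 2)])
  have hc_le : ∀ s, |X s 2| ≤ h s := fun s =>
    abs_le_sqrt (by simp only [hf]; nlinarith [sq_nonneg (X s 1)])
  have hder : ∀ s, HasDerivAt h
      ((2 * ε * X s 0 ^ 2 * X s 1 + 2 * ε ^ 2 * exp (-K ^ 10) * X s 0 ^ 2 * X s 2)
        / (2 * sqrt (f s + ε ^ 2))) s := fun s =>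
    ((delayCircuit_bc_energy (hX s)).add_const (ε ^ 2)).sqrt (hfpos s).ne'
  have hbound : ∀ s, (2 * ε * X s 0 ^ 2 * X s 1 + 2 * ε ^ 2 * exp (-K ^ 10) * X s 0 ^ 2 * X s 2)
        / (2 * sqrt (f s + ε ^ 2)) ≤ 2 * ε := by
    intro s
    have hhpos : 0 < sqrt (f s + ε ^ 2) := sqrt_pos.2 (hfpos s)
    rw [div_le_iff₀ (by positivity)]
    have ha : X s 0 ^ 2 ≤ 1 := traj_sq_le_one hX h0 s 0
    have ha0 : 0 ≤ X s 0 ^ 2 := sq_nonneg _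
    have hek : exp (-K ^ 10) ≤ 1 := by
      rw [exp_le_one_iff, neg_nonpos]; positivity
    have hbs : |X s 1| ≤ h s := hb_le s
    have hcs : |X s 2| ≤ h s := hc_le s
    have hb1 : X s 1 ≤ h s := (le_abs_self _).trans hbs
    have hc1 : X s 2 ≤ h s := (le_abs_self _).trans hcs
    have hc2 : -h s ≤ X s 2 := by have := neg_abs_le (X s 2); linarith
    have hh0 : 0 ≤ h s := (abs_nonneg _).trans hbs
    -- `a² b ≤ h`, `ε² e^{-k} a² c ≤ ε h`
    have h1 : X s 0 ^ 2 * X s 1 ≤ h s := by nlinarith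
    have h21 : ε ^ 2 * exp (-K ^ 10) ≤ ε := by
      calc ε ^ 2 * exp (-K ^ 10) ≤ ε ^ 2 * 1 :=
            mul_le_mul_of_nonneg_left hek (sq_nonneg _)
        _ = ε * ε := by ring
        _ ≤ ε * 1 := mul_le_mul_of_nonneg_left hε1 hε.le
        _ = ε := mul_one _
    have hεe : 0 ≤ ε ^ 2 * exp (-K ^ 10) := by positivity
    have h22 : |X s 0 ^ 2 * X s 2| ≤ h s := by
      rw [abs_mul, abs_of_nonneg ha0]; nlinarith [abs_nonneg (X s 2)]
    have h23 : ε ^ 2 * exp (-K ^ 10) * (X s 0 ^ 2 * X s 2) ≤ ε * h s := by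
      calc ε ^ 2 * exp (-K ^ 10) * (X s 0 ^ 2 * X s 2)
          ≤ ε ^ 2 * exp (-K ^ 10) * |X s 0 ^ 2 * X s 2| :=
            mul_le_mul_of_nonneg_left (le_abs_self _) hεe
        _ ≤ ε * h s := mul_le_mul h21 h22 (abs_nonneg _) hε.le
    have : h s = sqrt (f s + ε ^ 2) := rfl
    rw [← this]
    nlinarith
  -- `h - 2εt` is antitone on `[0,2]`
  have hanti := antitoneOn_sub_of_deriv_le (convex_Icc 0 2) (fun s _ => hder s)
    (fun s _ => ((hasDerivAt_id s).const_mul (2 * ε))) (fun s _ => by simpa using hbound s)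
  have h0mem : (0 : ℝ) ∈ Icc (0 : ℝ) 2 := ⟨le_rfl, by norm_num⟩
  have hmono := hanti h0mem ht ht.1
  have hh0 : h 0 = ε := by
    simp only [hh, hf, init_b h0, init_c h0]
    simpa using sqrt_sq hε.le
  simp only [hh0, id, mul_zero, sub_zero] at hmono
  have hht : h t ≤ 5 * ε := by
    have := ht.2
    nlinarith
  exact ⟨(hb_le t).trans hht, (hc_le t).trans hht⟩

/-! ## `c ≥ 0` and the crude Grönwall bound (code) -/

/-- `c(t) ≥ 0` for `t ≥ 0` ("from the initial condition `c(0)=0` and a comparison argument"),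
via the integrating factor `exp(-∫₀ᵗ ε⁻¹K¹⁰ b)`. [cite: Tao2016AveragedNS, §5.5 proof] -/
theorem c_nonneg (hX : ∀ t, HasDerivAt X (delayCircuit K ε (X t)) t) (h0 : X 0 = delayInit)
    {t : ℝ} (ht : 0 ≤ t) : 0 ≤ X t 2 := by
  set G : ℝ → ℝ := fun s => ∫ r in (0 : ℝ)..s, ε⁻¹ * K ^ 10 * X r 1 with hG
  have hGd : ∀ s, HasDerivAt G (ε⁻¹ * K ^ 10 * X s 1) s := fun s =>
    ((continuous_const.mul (continuous_traj hX 1)).integral_hasStrictDerivAt 0 s).hasDerivAt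
  have hmono := monotoneOn_intFactor (s := univ) (φ := fun _ => 0) (Φ := fun _ => 0) convex_univ
    (fun s _ => hasDerivAt_c hX s) (fun s _ => hGd s) (fun s _ => hasDerivAt_const s (0 : ℝ))
    (fun s _ => by
      have : (ε ^ 2 * exp (-K ^ 10) * X s 0 ^ 2 + ε⁻¹ * K ^ 10 * X s 1 * X s 2
          - ε⁻¹ * K ^ 10 * X s 1 * X s 2) * exp (-G s)
          = ε ^ 2 * exp (-K ^ 10) * X s 0 ^ 2 * exp (-G s) := by ring
      rw [this]; positivity)
  have h := hmono (mem_univ 0) (mem_univ t) ht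
  simp only [init_c h0, zero_mul, sub_zero] at h
  exact (mul_nonneg_iff_of_pos_right (exp_pos (-G t))).1 h

/-- (code): the crude Grönwall bound `c(t) ≤ 2ε² e^{(5t-1)K¹⁰}` on `[0,2]` (from
`∂ₜc ≤ μ + 5K¹⁰ c`). [cite: Tao2016AveragedNS, §5.5 (code)] -/
theorem c_crude (hX : ∀ t, HasDerivAt X (delayCircuit K ε (X t)) t) (h0 : X 0 = delayInit)
    (hε : 0 < ε) (hε1 : ε ≤ 1) {t : ℝ} (ht : t ∈ Icc 0 2) :
    X t 2 ≤ 2 * ε ^ 2 * exp ((5 * t - 1) * K ^ 10) := by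
  set μ := ε ^ 2 * exp (-K ^ 10) with hμ
  have hμ0 : 0 ≤ μ := by positivity
  have hanti := antitoneOn_intFactor (s := Icc 0 2) (g := fun _ => 5 * K ^ 10)
    (G := fun s => 5 * K ^ 10 * s) (φ := fun _ => μ) (Φ := fun s => μ * s) (convex_Icc 0 2)
    (fun s _ => hasDerivAt_c hX s)
    (fun s _ => ((hasDerivAt_id s).const_mul (5 * K ^ 10)).congr_deriv (by simp))
    (fun s _ => ((hasDerivAt_id s).const_mul μ).congr_deriv (by simp))
    (fun s hs => by
      have hc0 : 0 ≤ X s 2 := c_nonneg hX h0 hs.1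
      have hb : |X s 1| ≤ 5 * ε := (bc_small hX h0 hε hε1 hs).1
      have ha : X s 0 ^ 2 ≤ 1 := traj_sq_le_one hX h0 s 0
      have hexp : exp (-(5 * K ^ 10 * s)) ≤ 1 := by
        rw [exp_le_one_iff, neg_nonpos]; have := hs.1; positivity
      have hk : 0 ≤ K ^ 10 := by positivity
      have h1 : ε ^ 2 * exp (-K ^ 10) * X s 0 ^ 2 ≤ μ := by
        simpa [hμ] using mul_le_mul_of_nonneg_left ha (by positivity : 0 ≤ ε ^ 2 * exp (-K ^ 10))
      have h2 : ε⁻¹ * K ^ 10 * X s 1 * X s 2 ≤ 5 * K ^ 10 * X s 2 := by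
        have hb' : X s 1 ≤ 5 * ε := (le_abs_self _).trans hb
        have h5 : ε⁻¹ * X s 1 ≤ 5 := by
          rw [inv_mul_le_iff₀ hε]; linarith
        have : ε⁻¹ * K ^ 10 * X s 1 * X s 2 = (ε⁻¹ * X s 1) * (K ^ 10 * X s 2) := by ring
        rw [this]
        nlinarith [mul_nonneg hk hc0]
      have hbr : ε ^ 2 * exp (-K ^ 10) * X s 0 ^ 2 + ε⁻¹ * K ^ 10 * X s 1 * X s 2
          - 5 * K ^ 10 * X s 2 ≤ μ := by linarith
      calc (ε ^ 2 * exp (-K ^ 10) * X s 0 ^ 2 + ε⁻¹ * K ^ 10 * X s 1 * X s 2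
            - 5 * K ^ 10 * X s 2) * exp (-(5 * K ^ 10 * s))
          ≤ μ * exp (-(5 * K ^ 10 * s)) := mul_le_mul_of_nonneg_right hbr (exp_pos _).le
        _ ≤ μ * 1 := mul_le_mul_of_nonneg_left hexp hμ0
        _ = μ := mul_one _)
  have h0mem : (0 : ℝ) ∈ Icc (0 : ℝ) 2 := ⟨le_rfl, by norm_num⟩
  have h := hanti h0mem ht ht.1
  simp only [init_c h0, zero_mul, mul_zero, sub_zero] at h
  -- `c t * exp(-5kt) - μ t ≤ 0`
  have h' : X t 2 * exp (-(5 * K ^ 10 * t)) ≤ μ * t := by linarith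
  have hexp : X t 2 = X t 2 * exp (-(5 * K ^ 10 * t)) * exp (5 * K ^ 10 * t) := by
    rw [mul_assoc, ← exp_add, neg_add_cancel, exp_zero, mul_one]
  rw [hexp]
  calc X t 2 * exp (-(5 * K ^ 10 * t)) * exp (5 * K ^ 10 * t)
      ≤ μ * t * exp (5 * K ^ 10 * t) := mul_le_mul_of_nonneg_right h' (exp_pos _).le
    _ ≤ μ * 2 * exp (5 * K ^ 10 * t) := by
        have := ht.2
        exact mul_le_mul_of_nonneg_right (mul_le_mul_of_nonneg_left this hμ0) (exp_pos _).le
    _ = 2 * ε ^ 2 * exp ((5 * t - 1) * K ^ 10) := by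
        simp only [hμ]
        rw [show (5 * t - 1) * K ^ 10 = -K ^ 10 + 5 * K ^ 10 * t by ring, exp_add]
        ring

end Trajectory


/-! ## Toolkit 4: two-sided derivative bound -/

/-- `|f'| ≤ M` on `[t₀,t₁]` ⇒ `|f t - f t₀| ≤ M (t - t₀)`. [folklore] -/
theorem abs_sub_le_of_abs_deriv_le {f f' : ℝ → ℝ} {t₀ t₁ M : ℝ}
    (hf : ∀ t ∈ Icc t₀ t₁, HasDerivAt f (f' t) t) (hM : ∀ t ∈ Icc t₀ t₁, |f' t| ≤ M)
    {t : ℝ} (ht : t ∈ Icc t₀ t₁) : |f t - f t₀| ≤ M * (t - t₀) := by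
  have h0 : t₀ ∈ Icc t₀ t₁ := ⟨le_rfl, ht.1.trans ht.2⟩
  have hup := antitoneOn_sub_of_deriv_le (φ := fun _ => M) (Φ := fun s => M * s)
    (convex_Icc t₀ t₁) hf
    (fun s _ => ((hasDerivAt_id s).const_mul M).congr_deriv (by simp))
    (fun s hs => (le_abs_self _).trans (hM s hs)) h0 ht ht.1
  have hdn := monotoneOn_sub_of_le_deriv (φ := fun _ => -M) (Φ := fun s => -M * s)
    (convex_Icc t₀ t₁) hf
    (fun s _ => ((hasDerivAt_id s).const_mul (-M)).congr_deriv (by simp))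
    (fun s hs => by have := neg_abs_le (f' s); have := hM s hs; linarith) h0 ht ht.1
  simp only at hup hdn
  rw [abs_le]
  constructor <;> linarith

section PhaseOne

/-! ## Up to the critical time: (dora), (able2), (bogo-2) and the sharp comparison for `c`

Throughout, `τ` is a time with `c ≤ K⁻¹⁰ε²` on `[0,τ]` ((boots); it will be the hitting time). -/

variable {K ε τ : ℝ} {X : ℝ → Fin 5 → ℝ}

/-- (dora): `|d|, |ã| ≤ 3K⁻¹⁰` on `[0,τ]`, from `∂ₜ(d²+ã²) = 2ε⁻²c·a·d` applied to
`√(d²+ã²+K⁻²⁰)`. [cite: Tao2016AveragedNS, §5.5 (dora)] -/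
theorem de_small (hX : ∀ t, HasDerivAt X (delayCircuit K ε (X t)) t) (h0 : X 0 = delayInit)
    (hε : 0 < ε) (hK : 0 < K) (hτ2 : τ ≤ 2)
    (hcτ : ∀ t, 0 ≤ t → t ≤ τ → X t 2 ≤ ε ^ 2 / K ^ 10)
    {t : ℝ} (ht : t ∈ Icc 0 τ) : |X t 3| ≤ 3 / K ^ 10 ∧ |X t 4| ≤ 3 / K ^ 10 := by
  set κ : ℝ := (K ^ 10)⁻¹ with hκ
  have hκ0 : 0 < κ := by positivity
  set u : ℝ → ℝ := fun s => X s 3 ^ 2 + X s 4 ^ 2 with hu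
  set h : ℝ → ℝ := fun s => sqrt (u s + κ ^ 2) with hh
  have hupos : ∀ s, 0 < u s + κ ^ 2 := fun s => by positivity
  have hd_le : ∀ s, |X s 3| ≤ h s := fun s =>
    abs_le_sqrt (by simp only [hu]; nlinarith [sq_nonneg (X s 4)])
  have he_le : ∀ s, |X s 4| ≤ h s := fun s =>
    abs_le_sqrt (by simp only [hu]; nlinarith [sq_nonneg (X s 3)])
  have hder : ∀ s, HasDerivAt h
      ((2 * (ε ^ 2)⁻¹ * X s 2 * X s 0 * X s 3) / (2 * sqrt (u s + κ ^ 2))) s := fun s =>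
    ((delayCircuit_out_energy (hX s)).add_const (κ ^ 2)).sqrt (hupos s).ne'
  have hbound : ∀ s ∈ Icc 0 τ,
      (2 * (ε ^ 2)⁻¹ * X s 2 * X s 0 * X s 3) / (2 * sqrt (u s + κ ^ 2)) ≤ κ := by
    intro s hs
    have hhpos : 0 < sqrt (u s + κ ^ 2) := sqrt_pos.2 (hupos s)
    rw [div_le_iff₀ (by positivity)]
    have hc0 : 0 ≤ X s 2 := c_nonneg hX h0 hs.1
    have hcθ : X s 2 ≤ ε ^ 2 / K ^ 10 := hcτ s hs.1 hs.2
    have ha : |X s 0| ≤ 1 := traj_abs_le_one hX h0 s 0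
    have hds : |X s 3| ≤ h s := hd_le s
    have hh' : h s = sqrt (u s + κ ^ 2) := rfl
    rw [← hh']
    have h1 : |X s 0 * X s 3| ≤ h s := by
      rw [abs_mul]
      calc |X s 0| * |X s 3| ≤ 1 * h s := mul_le_mul ha hds (abs_nonneg _) zero_le_one
        _ = h s := one_mul _
    have h2 : (ε ^ 2)⁻¹ * X s 2 ≤ κ := by
      calc (ε ^ 2)⁻¹ * X s 2 ≤ (ε ^ 2)⁻¹ * (ε ^ 2 / K ^ 10) :=
            mul_le_mul_of_nonneg_left hcθ (by positivity)
        _ = κ := by simp only [hκ]; field_simp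
    have h3 : 0 ≤ (ε ^ 2)⁻¹ * X s 2 := by positivity
    have h4 : (ε ^ 2)⁻¹ * X s 2 * (X s 0 * X s 3) ≤ κ * h s :=
      calc (ε ^ 2)⁻¹ * X s 2 * (X s 0 * X s 3) ≤ (ε ^ 2)⁻¹ * X s 2 * |X s 0 * X s 3| :=
            mul_le_mul_of_nonneg_left (le_abs_self _) h3
        _ ≤ κ * h s := mul_le_mul h2 h1 (abs_nonneg _) hκ0.le
    have : 2 * (ε ^ 2)⁻¹ * X s 2 * X s 0 * X s 3 = 2 * ((ε ^ 2)⁻¹ * X s 2 * (X s 0 * X s 3)) := by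
      ring
    rw [this]
    linarith
  have hanti := antitoneOn_sub_of_deriv_le (Φ := fun s => κ * s) (convex_Icc 0 τ)
    (fun s _ => hder s) (fun s _ => ((hasDerivAt_id s).const_mul κ).congr_deriv (by simp)) hbound
  have h0mem : (0 : ℝ) ∈ Icc (0 : ℝ) τ := ⟨le_rfl, ht.1.trans ht.2⟩
  have hmono := hanti h0mem ht ht.1
  have hh0 : h 0 = κ := by
    simp only [hh, hu, init_d h0, init_e h0]
    simpa using sqrt_sq hκ0.le
  simp only [hh0, mul_zero, sub_zero] at hmono
  have hht : h t ≤ 3 / K ^ 10 := by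
    have ht2 : t ≤ 2 := ht.2.trans hτ2
    have : h t ≤ κ + κ * t := by linarith
    calc h t ≤ κ + κ * t := this
      _ ≤ κ + κ * 2 := by nlinarith
      _ = 3 / K ^ 10 := by simp only [hκ]; ring
  exact ⟨(hd_le t).trans hht, (he_le t).trans hht⟩

/-- (able2) for `a`: `|a - 1| ≤ 8K⁻²⁰` on `[0,τ]` (from `∂ₜa = O(K⁻²⁰) + O(ε²)`).
[cite: Tao2016AveragedNS, §5.5 (able2)] -/
theorem a_near_one (hX : ∀ t, HasDerivAt X (delayCircuit K ε (X t)) t) (h0 : X 0 = delayInit)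
    (hε : 0 < ε) (hε1 : ε ≤ 1) (hK : 0 < K) (hτ2 : τ ≤ 2)
    (hεK : ε ^ 2 ≤ 1 / (6 * K ^ 20))
    (hcτ : ∀ t, 0 ≤ t → t ≤ τ → X t 2 ≤ ε ^ 2 / K ^ 10)
    {t : ℝ} (ht : t ∈ Icc 0 τ) : |X t 0 - 1| ≤ 8 / K ^ 20 := by
  have hM : ∀ s ∈ Icc 0 τ, |(-((ε ^ 2)⁻¹ * X s 2 * X s 3) - ε * X s 0 * X s 1
      - ε ^ 2 * exp (-K ^ 10) * X s 0 * X s 2)| ≤ 4 / K ^ 20 := by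
    intro s hs
    have hs2 : s ∈ Icc (0 : ℝ) 2 := ⟨hs.1, hs.2.trans hτ2⟩
    have hc0 : 0 ≤ X s 2 := c_nonneg hX h0 hs.1
    have hcθ : X s 2 ≤ ε ^ 2 / K ^ 10 := hcτ s hs.1 hs.2
    have hd : |X s 3| ≤ 3 / K ^ 10 := (de_small hX h0 hε hK hτ2 hcτ hs).1
    have ha : |X s 0| ≤ 1 := traj_abs_le_one hX h0 s 0
    have hb : |X s 1| ≤ 5 * ε := (bc_small hX h0 hε hε1 hs2).1
    have hc1 : |X s 2| ≤ 1 := traj_abs_le_one hX h0 s 2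
    have hek : exp (-K ^ 10) ≤ 1 := by rw [exp_le_one_iff, neg_nonpos]; positivity
    -- term 1: `|ρ c d| ≤ 3 K⁻²⁰`
    have h1 : |(ε ^ 2)⁻¹ * X s 2 * X s 3| ≤ 3 / K ^ 20 := by
      rw [abs_mul, abs_of_nonneg (by positivity : 0 ≤ (ε ^ 2)⁻¹ * X s 2)]
      calc (ε ^ 2)⁻¹ * X s 2 * |X s 3| ≤ (ε ^ 2)⁻¹ * (ε ^ 2 / K ^ 10) * (3 / K ^ 10) :=
            mul_le_mul (mul_le_mul_of_nonneg_left hcθ (by positivity)) hd (abs_nonneg _)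
              (by positivity)
        _ = 3 / K ^ 20 := by field_simp
    -- term 2: `|ε a b| ≤ 5ε²`
    have h2 : |ε * X s 0 * X s 1| ≤ 5 * ε ^ 2 := by
      rw [abs_mul, abs_mul, abs_of_pos hε]
      calc ε * |X s 0| * |X s 1| ≤ ε * 1 * (5 * ε) :=
            mul_le_mul (mul_le_mul_of_nonneg_left ha hε.le) hb (abs_nonneg _) (by positivity)
        _ = 5 * ε ^ 2 := by ring
    -- term 3: `|μ a c| ≤ ε²`
    have h3 : |ε ^ 2 * exp (-K ^ 10) * X s 0 * X s 2| ≤ ε ^ 2 := by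
      rw [abs_mul, abs_mul, abs_mul, abs_of_pos (pow_pos hε 2), abs_of_pos (exp_pos _)]
      calc ε ^ 2 * exp (-K ^ 10) * |X s 0| * |X s 2| ≤ ε ^ 2 * 1 * 1 * 1 :=
            mul_le_mul (mul_le_mul (mul_le_mul_of_nonneg_left hek (by positivity)) ha
              (abs_nonneg _) (by positivity)) hc1 (abs_nonneg _) (by positivity)
        _ = ε ^ 2 := by ring
    have h6 : 6 * ε ^ 2 ≤ 1 / K ^ 20 := by
      have := hεK
      rw [le_div_iff₀ (by positivity)] at this
      rw [le_div_iff₀ (by positivity)]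
      linarith
    calc |(-((ε ^ 2)⁻¹ * X s 2 * X s 3) - ε * X s 0 * X s 1 - ε ^ 2 * exp (-K ^ 10) * X s 0 * X s 2)|
        ≤ |(-((ε ^ 2)⁻¹ * X s 2 * X s 3) - ε * X s 0 * X s 1)|
          + |ε ^ 2 * exp (-K ^ 10) * X s 0 * X s 2| := abs_sub _ _
      _ ≤ |(-((ε ^ 2)⁻¹ * X s 2 * X s 3))| + |ε * X s 0 * X s 1|
          + |ε ^ 2 * exp (-K ^ 10) * X s 0 * X s 2| := by
          have := abs_sub (-((ε ^ 2)⁻¹ * X s 2 * X s 3)) (ε * X s 0 * X s 1)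
          linarith
      _ ≤ 3 / K ^ 20 + 5 * ε ^ 2 + ε ^ 2 := by rw [abs_neg]; linarith
      _ ≤ 4 / K ^ 20 := by
          have : 3 / K ^ 20 + 6 * ε ^ 2 ≤ 3 / K ^ 20 + 1 / K ^ 20 := by linarith
          calc 3 / K ^ 20 + 5 * ε ^ 2 + ε ^ 2 = 3 / K ^ 20 + 6 * ε ^ 2 := by ring
            _ ≤ 3 / K ^ 20 + 1 / K ^ 20 := this
            _ = 4 / K ^ 20 := by ring
  have := abs_sub_le_of_abs_deriv_le (fun s _ => hasDerivAt_a hX s) hM ht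
  rw [init_a h0, sub_zero] at this
  calc |X t 0 - 1| ≤ 4 / K ^ 20 * t := this
    _ ≤ 4 / K ^ 20 * 2 := by
        have : t ≤ 2 := ht.2.trans hτ2
        exact mul_le_mul_of_nonneg_left this (by positivity)
    _ = 8 / K ^ 20 := by ring

/-- (bogo-2): `|b - εt| ≤ 17εt·K⁻²⁰` on `[0,τ]` (from `∂ₜb = ε + O(K⁻²⁰ε) + O(K⁻¹⁰ε³)`).
[cite: Tao2016AveragedNS, §5.5 (bogo-2)] -/
theorem b_linear (hX : ∀ t, HasDerivAt X (delayCircuit K ε (X t)) t) (h0 : X 0 = delayInit)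
    (hε : 0 < ε) (hε1 : ε ≤ 1) (hK : 1 ≤ K) (hτ2 : τ ≤ 2)
    (hεK : ε ^ 2 ≤ 1 / (6 * K ^ 20))
    (hcτ : ∀ t, 0 ≤ t → t ≤ τ → X t 2 ≤ ε ^ 2 / K ^ 10)
    {t : ℝ} (ht : t ∈ Icc 0 τ) : |X t 1 - ε * t| ≤ 17 * ε / K ^ 20 * t := by
  have hK0 : 0 < K := by linarith
  have hM : ∀ s ∈ Icc 0 τ,
      |ε * X s 0 ^ 2 - ε⁻¹ * K ^ 10 * X s 2 ^ 2 - ε * 1| ≤ 17 * ε / K ^ 20 := by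
    intro s hs
    have hc0 : 0 ≤ X s 2 := c_nonneg hX h0 hs.1
    have hcθ : X s 2 ≤ ε ^ 2 / K ^ 10 := hcτ s hs.1 hs.2
    have ha1 : |X s 0 - 1| ≤ 8 / K ^ 20 := a_near_one hX h0 hε hε1 hK0 hτ2 hεK hcτ hs
    have ha : |X s 0| ≤ 1 := traj_abs_le_one hX h0 s 0
    -- `|ε (a² - 1)| ≤ 16 ε K⁻²⁰`
    have h1 : |ε * (X s 0 ^ 2 - 1)| ≤ 16 * ε / K ^ 20 := by
      rw [abs_mul, abs_of_pos hε, show X s 0 ^ 2 - 1 = (X s 0 - 1) * (X s 0 + 1) by ring, abs_mul]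
      have hp1 : |X s 0 + 1| ≤ 2 := by
        calc |X s 0 + 1| ≤ |X s 0| + |1| := abs_add_le _ _
          _ ≤ 1 + 1 := by rw [abs_one]; linarith
          _ = 2 := by norm_num
      calc ε * (|X s 0 - 1| * |X s 0 + 1|) ≤ ε * (8 / K ^ 20 * 2) :=
            mul_le_mul_of_nonneg_left (mul_le_mul ha1 hp1 (abs_nonneg _) (by positivity)) hε.le
        _ = 16 * ε / K ^ 20 := by ring
    -- `0 ≤ ν c² ≤ ε³ K⁻¹⁰ ≤ ε K⁻²⁰`
    have h2 : 0 ≤ ε⁻¹ * K ^ 10 * X s 2 ^ 2 := by positivity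
    have h3 : ε⁻¹ * K ^ 10 * X s 2 ^ 2 ≤ ε / K ^ 20 := by
      have hc2 : X s 2 ^ 2 ≤ (ε ^ 2 / K ^ 10) ^ 2 := pow_le_pow_left₀ hc0 hcθ 2
      have hε2 : ε ^ 2 ≤ 1 / K ^ 10 := by
        calc ε ^ 2 ≤ 1 / (6 * K ^ 20) := hεK
          _ ≤ 1 / K ^ 10 := by
              apply one_div_le_one_div_of_le (by positivity)
              have : K ^ 10 ≤ K ^ 20 := pow_le_pow_right₀ hK (by norm_num)
              nlinarith
      calc ε⁻¹ * K ^ 10 * X s 2 ^ 2 ≤ ε⁻¹ * K ^ 10 * (ε ^ 2 / K ^ 10) ^ 2 :=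
            mul_le_mul_of_nonneg_left hc2 (by positivity)
        _ = ε * ε ^ 2 / K ^ 10 := by field_simp
        _ ≤ ε * (1 / K ^ 10) / K ^ 10 := by
            exact div_le_div_of_nonneg_right (mul_le_mul_of_nonneg_left hε2 hε.le) (by positivity)
        _ = ε / K ^ 20 := by field_simp
    rw [show ε * X s 0 ^ 2 - ε⁻¹ * K ^ 10 * X s 2 ^ 2 - ε * 1
        = ε * (X s 0 ^ 2 - 1) - ε⁻¹ * K ^ 10 * X s 2 ^ 2 by ring]
    calc |ε * (X s 0 ^ 2 - 1) - ε⁻¹ * K ^ 10 * X s 2 ^ 2|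
        ≤ |ε * (X s 0 ^ 2 - 1)| + |ε⁻¹ * K ^ 10 * X s 2 ^ 2| := abs_sub _ _
      _ ≤ 16 * ε / K ^ 20 + ε / K ^ 20 := by rw [abs_of_nonneg h2]; linarith
      _ = 17 * ε / K ^ 20 := by ring
  have hder : ∀ s ∈ Icc 0 τ, HasDerivAt (fun r => X r 1 - ε * r)
      (ε * X s 0 ^ 2 - ε⁻¹ * K ^ 10 * X s 2 ^ 2 - ε * 1) s := fun s _ =>
    (hasDerivAt_b hX s).sub ((hasDerivAt_id s).const_mul ε)
  have := abs_sub_le_of_abs_deriv_le hder hM ht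
  simpa [init_b h0] using this

/-- Sharp super-solution for `c` on `[0,τ]`: `c(t) ≤ 2ε² exp(K¹⁰t²/2 + 1 - K¹⁰)` (integrating
factor `exp(-(K¹⁰t²/2 + βt))`, `β = 34K⁻¹⁰`). [cite: Tao2016AveragedNS, §5.5 proof of (tcable)] -/
theorem c_upper_sharp (hX : ∀ t, HasDerivAt X (delayCircuit K ε (X t)) t) (h0 : X 0 = delayInit)
    (hε : 0 < ε) (hε1 : ε ≤ 1) (hK : 2 ≤ K) (hτ2 : τ ≤ 2)
    (hεK : ε ^ 2 ≤ 1 / (6 * K ^ 20))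
    (hcτ : ∀ t, 0 ≤ t → t ≤ τ → X t 2 ≤ ε ^ 2 / K ^ 10)
    {t : ℝ} (ht : t ∈ Icc 0 τ) :
    X t 2 ≤ 2 * ε ^ 2 * exp (K ^ 10 * t ^ 2 / 2 + 1 - K ^ 10) := by
  have hK0 : 0 < K := by linarith
  have hK1 : 1 ≤ K := by linarith
  set k : ℝ := K ^ 10 with hk
  have hk0 : 0 < k := by positivity
  have hk68 : 68 ≤ k := by
    have : (2 : ℝ) ^ 10 ≤ K ^ 10 := pow_le_pow_left₀ (by norm_num) hK 10
    simp only [hk]; nlinarith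
  set β : ℝ := 34 / k with hβ
  have hβ0 : 0 ≤ β := by positivity
  have hβ1 : β ≤ 1 / 2 := by
    simp only [hβ]; rw [div_le_div_iff₀ hk0 (by norm_num)]; linarith
  set μ : ℝ := ε ^ 2 * exp (-k) with hμ
  have hμ0 : 0 ≤ μ := by positivity
  -- integrating factor `G(s) = k s²/2 + β s`
  have hG : ∀ s, HasDerivAt (fun r : ℝ => k / 2 * (r * r) + β * r) (k * s + β) s := by
    intro s
    have := (((hasDerivAt_id s).mul (hasDerivAt_id s)).const_mul (k / 2)).add
      ((hasDerivAt_id s).const_mul β)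
    exact this.congr_deriv (by simp; ring)
  have hanti := antitoneOn_intFactor (s := Icc 0 τ) (g := fun s => k * s + β)
    (G := fun r => k / 2 * (r * r) + β * r) (φ := fun _ => μ) (Φ := fun s => μ * s)
    (convex_Icc 0 τ) (fun s _ => hasDerivAt_c hX s) (fun s _ => hG s)
    (fun s _ => ((hasDerivAt_id s).const_mul μ).congr_deriv (by simp))
    (fun s hs => by
      have hc0 : 0 ≤ X s 2 := c_nonneg hX h0 hs.1
      have ha : X s 0 ^ 2 ≤ 1 := traj_sq_le_one hX h0 s 0
      have hb : |X s 1 - ε * s| ≤ 17 * ε / K ^ 20 * s :=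
        b_linear hX h0 hε hε1 hK1 hτ2 hεK hcτ hs
      have hs2 : s ≤ 2 := hs.2.trans hτ2
      -- `ν b ≤ k s + β`
      have hνb : ε⁻¹ * K ^ 10 * X s 1 ≤ k * s + β := by
        have hb' : X s 1 ≤ ε * s + 17 * ε / K ^ 20 * s := by
          have := (abs_le.1 hb).2; linarith
        have h34 : 17 * ε / K ^ 20 * s ≤ 34 * ε / K ^ 20 := by
          have h2s : 17 * ε / K ^ 20 * s ≤ 17 * ε / K ^ 20 * 2 :=
            mul_le_mul_of_nonneg_left hs2 (by positivity)
          have h2e : 17 * ε / K ^ 20 * 2 = 34 * ε / K ^ 20 := by ring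
          linarith
        calc ε⁻¹ * K ^ 10 * X s 1 ≤ ε⁻¹ * K ^ 10 * (ε * s + 34 * ε / K ^ 20) :=
              mul_le_mul_of_nonneg_left (by linarith) (by positivity)
          _ = k * s + β := by
              simp only [hβ, hk]; field_simp
      have hexp : exp (-(k / 2 * (s * s) + β * s)) ≤ 1 := by
        rw [exp_le_one_iff, neg_nonpos]; have := hs.1; positivity
      have hbr : ε ^ 2 * exp (-K ^ 10) * X s 0 ^ 2 + ε⁻¹ * K ^ 10 * X s 1 * X s 2
          - (k * s + β) * X s 2 ≤ μ := by
        have h1 : ε ^ 2 * exp (-K ^ 10) * X s 0 ^ 2 ≤ μ := by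
          simpa [hμ, hk] using mul_le_mul_of_nonneg_left ha
            (by positivity : 0 ≤ ε ^ 2 * exp (-K ^ 10))
        have h2 : ε⁻¹ * K ^ 10 * X s 1 * X s 2 ≤ (k * s + β) * X s 2 :=
          mul_le_mul_of_nonneg_right hνb hc0
        linarith
      calc (ε ^ 2 * exp (-K ^ 10) * X s 0 ^ 2 + ε⁻¹ * K ^ 10 * X s 1 * X s 2
            - (k * s + β) * X s 2) * exp (-(k / 2 * (s * s) + β * s))
          ≤ μ * exp (-(k / 2 * (s * s) + β * s)) :=
            mul_le_mul_of_nonneg_right hbr (exp_pos _).le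
        _ ≤ μ * 1 := mul_le_mul_of_nonneg_left hexp hμ0
        _ = μ := mul_one _)
  have h0mem : (0 : ℝ) ∈ Icc (0 : ℝ) τ := ⟨le_rfl, ht.1.trans ht.2⟩
  have h := hanti h0mem ht ht.1
  simp only [init_c h0, zero_mul, mul_zero, sub_zero, add_zero] at h
  have h' : X t 2 * exp (-(k / 2 * (t * t) + β * t)) ≤ μ * t := by linarith
  have ht2 : t ≤ 2 := ht.2.trans hτ2
  have hE : X t 2 = X t 2 * exp (-(k / 2 * (t * t) + β * t)) * exp (k / 2 * (t * t) + β * t) := by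
    rw [mul_assoc, ← exp_add, neg_add_cancel, exp_zero, mul_one]
  rw [hE]
  calc X t 2 * exp (-(k / 2 * (t * t) + β * t)) * exp (k / 2 * (t * t) + β * t)
      ≤ μ * t * exp (k / 2 * (t * t) + β * t) := mul_le_mul_of_nonneg_right h' (exp_pos _).le
    _ ≤ μ * 2 * exp (k / 2 * (t * t) + 1) := by
        have hβt : β * t ≤ 1 := by nlinarith
        exact mul_le_mul (mul_le_mul_of_nonneg_left ht2 hμ0) (exp_le_exp.2 (by linarith))
          (exp_pos _).le (by positivity)
    _ = 2 * ε ^ 2 * exp (K ^ 10 * t ^ 2 / 2 + 1 - K ^ 10) := by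
        simp only [hμ, hk]
        rw [show K ^ 10 * t ^ 2 / 2 + 1 - K ^ 10 = -K ^ 10 + (K ^ 10 / 2 * (t * t) + 1) by ring,
          exp_add (-K ^ 10)]
        ring

/-- Sharp sub-solution for `c` on `[K⁻⁵, τ]` (needs `K⁻⁵ ≤ τ`):
`c(t) ≥ (ε²/(4K⁵)) exp(K¹⁰t²/2 - 1 - K¹⁰)` (integrating factor `exp(-(K¹⁰t²/2 - βt))`, first on
`[0,K⁻⁵]` where it is `≥ e^{-1/2}`, then on `[K⁻⁵,τ]`). [cite: Tao2016AveragedNS, §5.5 proof of (tcable)] -/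
theorem c_lower_sharp (hX : ∀ t, HasDerivAt X (delayCircuit K ε (X t)) t) (h0 : X 0 = delayInit)
    (hε : 0 < ε) (hε1 : ε ≤ 1) (hK : 2 ≤ K) (hτ2 : τ ≤ 2) (hτ5 : (K ^ 5)⁻¹ ≤ τ)
    (hεK : ε ^ 2 ≤ 1 / (6 * K ^ 20))
    (hcτ : ∀ t, 0 ≤ t → t ≤ τ → X t 2 ≤ ε ^ 2 / K ^ 10)
    {t : ℝ} (ht : t ∈ Icc (K ^ 5)⁻¹ τ) :
    ε ^ 2 / (4 * K ^ 5) * exp (K ^ 10 * t ^ 2 / 2 - 1 - K ^ 10) ≤ X t 2 := by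
  have hK0 : 0 < K := by linarith
  have hK1 : 1 ≤ K := by linarith
  set k : ℝ := K ^ 10 with hk
  have hk0 : 0 < k := by positivity
  have hk68 : 68 ≤ k := by
    have : (2 : ℝ) ^ 10 ≤ K ^ 10 := pow_le_pow_left₀ (by norm_num) hK 10
    simp only [hk]; nlinarith
  set β : ℝ := 34 / k with hβ
  have hβ0 : 0 ≤ β := by positivity
  have hβ1 : β ≤ 1 / 2 := by
    simp only [hβ]; rw [div_le_div_iff₀ hk0 (by norm_num)]; linarith
  set μ : ℝ := ε ^ 2 * exp (-k) with hμ
  have hμ0 : 0 ≤ μ := by positivity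
  set s₀ : ℝ := (K ^ 5)⁻¹ with hs₀
  have hs₀0 : 0 < s₀ := by positivity
  have hks₀ : k * (s₀ * s₀) = 1 := by simp only [hk, hs₀]; field_simp
  -- integrating factor `G(s) = k s²/2 - β s`
  have hG : ∀ s, HasDerivAt (fun r : ℝ => k / 2 * (r * r) - β * r) (k * s - β) s := by
    intro s
    have := (((hasDerivAt_id s).mul (hasDerivAt_id s)).const_mul (k / 2)).sub
      ((hasDerivAt_id s).const_mul β)
    exact this.congr_deriv (by simp; ring)
  -- the bracket `(c' - (ks-β)c) e^{-G} ≥ (μ/2) e^{-G}` on `[0,τ]`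
  have hbr : ∀ s ∈ Icc 0 τ, μ / 2 * exp (-(k / 2 * (s * s) - β * s)) ≤
      (ε ^ 2 * exp (-K ^ 10) * X s 0 ^ 2 + ε⁻¹ * K ^ 10 * X s 1 * X s 2
        - (k * s - β) * X s 2) * exp (-(k / 2 * (s * s) - β * s)) := by
    intro s hs
    have hc0 : 0 ≤ X s 2 := c_nonneg hX h0 hs.1
    have ha1 : |X s 0 - 1| ≤ 8 / K ^ 20 := a_near_one hX h0 hε hε1 hK0 hτ2 hεK hcτ hs
    have hb : |X s 1 - ε * s| ≤ 17 * ε / K ^ 20 * s :=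
      b_linear hX h0 hε hε1 hK1 hτ2 hεK hcτ hs
    have hs2 : s ≤ 2 := hs.2.trans hτ2
    -- `a² ≥ 1/2`
    have hK20 : 8 / K ^ 20 ≤ 1 / 4 := by
      rw [div_le_div_iff₀ (by positivity) (by norm_num)]
      have : (2 : ℝ) ^ 20 ≤ K ^ 20 := pow_le_pow_left₀ (by norm_num) hK 20
      nlinarith
    have ha_lo : 3 / 4 ≤ X s 0 := by have := (abs_le.1 ha1).1; linarith
    have ha2 : 1 / 2 ≤ X s 0 ^ 2 := by nlinarith
    -- `ν b ≥ k s - β`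
    have hνb : k * s - β ≤ ε⁻¹ * K ^ 10 * X s 1 := by
      have hb' : ε * s - 17 * ε / K ^ 20 * s ≤ X s 1 := by
        have := (abs_le.1 hb).1; linarith
      have h34 : 17 * ε / K ^ 20 * s ≤ 34 * ε / K ^ 20 := by
        have h2s : 17 * ε / K ^ 20 * s ≤ 17 * ε / K ^ 20 * 2 :=
          mul_le_mul_of_nonneg_left hs2 (by positivity)
        have h2e : 17 * ε / K ^ 20 * 2 = 34 * ε / K ^ 20 := by ring
        linarith
      calc k * s - β = ε⁻¹ * K ^ 10 * (ε * s - 34 * ε / K ^ 20) := by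
            simp only [hβ, hk]; field_simp
        _ ≤ ε⁻¹ * K ^ 10 * X s 1 :=
            mul_le_mul_of_nonneg_left (by linarith) (by positivity)
    have h1 : μ / 2 ≤ ε ^ 2 * exp (-K ^ 10) * X s 0 ^ 2 := by
      have : ε ^ 2 * exp (-K ^ 10) * (1 / 2) ≤ ε ^ 2 * exp (-K ^ 10) * X s 0 ^ 2 :=
        mul_le_mul_of_nonneg_left ha2 (by positivity)
      simp only [hμ, hk] at this ⊢; linarith
    have h2 : (k * s - β) * X s 2 ≤ ε⁻¹ * K ^ 10 * X s 1 * X s 2 :=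
      mul_le_mul_of_nonneg_right hνb hc0
    have hbr' : μ / 2 ≤ ε ^ 2 * exp (-K ^ 10) * X s 0 ^ 2 + ε⁻¹ * K ^ 10 * X s 1 * X s 2
        - (k * s - β) * X s 2 := by linarith
    exact mul_le_mul_of_nonneg_right hbr' (exp_pos _).le
  -- Stage A: on `[0, s₀]`, `e^{-G} ≥ 1/2`, so `c e^{-G} - (μ/4) s` is monotone
  have hs₀τ : s₀ ≤ τ := hτ5
  have hmonoA := monotoneOn_intFactor (s := Icc 0 s₀) (g := fun s => k * s - β)
    (G := fun r => k / 2 * (r * r) - β * r) (φ := fun _ => μ / 4) (Φ := fun s => μ / 4 * s)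
    (convex_Icc 0 s₀) (fun s _ => hasDerivAt_c hX s) (fun s _ => hG s)
    (fun s _ => ((hasDerivAt_id s).const_mul (μ / 4)).congr_deriv (by simp))
    (fun s hs => by
      have hsτ : s ∈ Icc 0 τ := ⟨hs.1, hs.2.trans hs₀τ⟩
      have hexp : 1 / 2 ≤ exp (-(k / 2 * (s * s) - β * s)) := by
        have hss : k * (s * s) ≤ 1 := by
          calc k * (s * s) ≤ k * (s₀ * s₀) := by
                exact mul_le_mul_of_nonneg_left (mul_self_le_mul_self hs.1 hs.2) hk0.le
            _ = 1 := hks₀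
        have harg : -(1 / 2 : ℝ) ≤ -(k / 2 * (s * s) - β * s) := by
          have : 0 ≤ β * s := mul_nonneg hβ0 hs.1
          linarith
        calc (1 / 2 : ℝ) ≤ exp (-(1 / 2 : ℝ)) := by
              have h := Real.add_one_le_exp (-(1 / 2 : ℝ))
              linarith
          _ ≤ exp (-(k / 2 * (s * s) - β * s)) := exp_le_exp.2 harg
      calc μ / 4 = μ / 2 * (1 / 2) := by ring
        _ ≤ μ / 2 * exp (-(k / 2 * (s * s) - β * s)) :=
            mul_le_mul_of_nonneg_left hexp (by positivity)
        _ ≤ _ := hbr s hsτ)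
  have hA := hmonoA (⟨le_rfl, hs₀0.le⟩ : (0 : ℝ) ∈ Icc 0 s₀) ⟨hs₀0.le, le_rfl⟩ hs₀0.le
  simp only [init_c h0, zero_mul, mul_zero, sub_zero] at hA
  -- Stage B: on `[s₀, τ]`, `c e^{-G}` is monotone
  have hmonoB := monotoneOn_intFactor (s := Icc s₀ τ) (g := fun s => k * s - β)
    (G := fun r => k / 2 * (r * r) - β * r) (φ := fun _ => 0) (Φ := fun _ => 0)
    (convex_Icc s₀ τ) (fun s _ => hasDerivAt_c hX s) (fun s _ => hG s)
    (fun s _ => hasDerivAt_const s (0 : ℝ))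
    (fun s hs => by
      have hsτ : s ∈ Icc 0 τ := ⟨hs₀0.le.trans hs.1, hs.2⟩
      exact le_trans (by positivity) (hbr s hsτ))
  have hB := hmonoB (⟨le_rfl, hs₀τ⟩ : s₀ ∈ Icc s₀ τ) ht ht.1
  simp only [sub_zero] at hB
  -- combine: `c t e^{-G t} ≥ μ/4 s₀`
  have hct : μ / 4 * s₀ ≤ X t 2 * exp (-(k / 2 * (t * t) - β * t)) := by linarith
  have ht0 : 0 ≤ t := hs₀0.le.trans ht.1
  have ht2 : t ≤ 2 := ht.2.trans hτ2
  have hE : X t 2 = X t 2 * exp (-(k / 2 * (t * t) - β * t)) * exp (k / 2 * (t * t) - β * t) := by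
    rw [mul_assoc, ← exp_add, neg_add_cancel, exp_zero, mul_one]
  rw [hE]
  calc ε ^ 2 / (4 * K ^ 5) * exp (K ^ 10 * t ^ 2 / 2 - 1 - K ^ 10)
      = μ / 4 * s₀ * exp (k / 2 * (t * t) - 1) := by
        simp only [hμ, hk, hs₀]
        rw [show K ^ 10 * t ^ 2 / 2 - 1 - K ^ 10 = -K ^ 10 + (K ^ 10 / 2 * (t * t) - 1) by ring,
          exp_add (-K ^ 10)]
        field_simp
    _ ≤ μ / 4 * s₀ * exp (k / 2 * (t * t) - β * t) := by
        have hβt : β * t ≤ 1 := by nlinarith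
        exact mul_le_mul_of_nonneg_left (exp_le_exp.2 (by linarith)) (by positivity)
    _ ≤ X t 2 * exp (-(k / 2 * (t * t) - β * t)) * exp (k / 2 * (t * t) - β * t) :=
        mul_le_mul_of_nonneg_right hct (exp_pos _).le

end PhaseOne


/-! ## Numerics for the critical window -/

/-- `√2 > 1.4`. [folklore] -/
theorem sqrt_two_gt : (7 : ℝ) / 5 < sqrt 2 := by
  rw [lt_sqrt (by norm_num)]; norm_num

/-- `√2 < 1.42`. [folklore] -/
theorem sqrt_two_lt : sqrt 2 < 71 / 50 := by
  rw [sqrt_lt' (by norm_num)]; norm_num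

/-- For `K ≥ 16`: `s = 1/√K ∈ (0, 1/4]`, `K s = √K ≥ 4`, `K s² = 1`. [folklore] -/
theorem invSqrt_facts {K : ℝ} (hK : 16 ≤ K) :
    0 < (sqrt K)⁻¹ ∧ (sqrt K)⁻¹ ≤ 1 / 4 ∧ K * (sqrt K)⁻¹ = sqrt K ∧ 4 ≤ sqrt K ∧
      K * (sqrt K)⁻¹ ^ 2 = 1 := by
  have hK0 : 0 < K := by linarith
  have h4 : 4 ≤ sqrt K := by
    rw [show (4 : ℝ) = sqrt 16 by rw [show (16 : ℝ) = 4 ^ 2 by norm_num, sqrt_sq (by norm_num)]]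
    exact sqrt_le_sqrt hK
  have hs0 : 0 < sqrt K := by positivity
  refine ⟨by positivity, ?_, ?_, h4, ?_⟩
  · rw [inv_le_comm₀ hs0 (by norm_num)]; linarith
  · rw [← div_eq_mul_inv, div_sqrt]
  · rw [inv_pow, sq_sqrt hK0.le, mul_inv_cancel₀ hK0.ne']

/-- Exponent on the early side of the window: `τ ≤ √2 - 1/√K ⇒ K¹⁰τ²/2 - K¹⁰ ≤ -K⁹`. [folklore] -/
theorem exponent_early {K τ : ℝ} (hK : 16 ≤ K) (hτ0 : 0 ≤ τ) (hτ : τ ≤ sqrt 2 - (sqrt K)⁻¹) :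
    K ^ 10 * τ ^ 2 / 2 + 1 - K ^ 10 ≤ 1 - K ^ 9 := by
  obtain ⟨hs0, hs4, hKs, h4, hKs2⟩ := invSqrt_facts hK
  set s := (sqrt K)⁻¹ with hs
  have hK0 : 0 < K := by linarith
  have h2 : sqrt 2 ^ 2 = 2 := sq_sqrt (by norm_num)
  have hst : 0 ≤ sqrt 2 - s := by have := sqrt_two_gt; linarith
  have hτ2 : τ ^ 2 ≤ (sqrt 2 - s) ^ 2 := pow_le_pow_left₀ hτ0 hτ 2
  -- `(√2 - s)² = 2 - 2√2 s + s²` and `√2 - s/2 ≥ 1`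
  have hexp : (sqrt 2 - s) ^ 2 / 2 - 1 ≤ -s := by
    have : (sqrt 2 - s) ^ 2 = 2 - 2 * sqrt 2 * s + s ^ 2 := by ring_nf; rw [h2]; ring
    rw [this]
    have h1 : 1 ≤ sqrt 2 - s / 2 := by have := sqrt_two_gt; linarith
    nlinarith
  have hk9 : K ^ 9 ≤ K ^ 10 * s := by
    have : K ^ 10 * s = K ^ 9 * (K * s) := by ring
    rw [this, hKs]
    have : K ^ 9 * 1 ≤ K ^ 9 * sqrt K := mul_le_mul_of_nonneg_left (by linarith) (by positivity)
    linarith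
  have : K ^ 10 * τ ^ 2 / 2 - K ^ 10 ≤ K ^ 10 * (-s) := by
    have := mul_le_mul_of_nonneg_left (le_trans (by linarith : τ ^ 2 / 2 - 1 ≤ (sqrt 2 - s) ^ 2 / 2 - 1) hexp)
      (by positivity : (0 : ℝ) ≤ K ^ 10)
    linarith
  linarith

/-- Exponent on the late side of the window: at `T = √2 + 1/√K`, `K¹⁰T²/2 - K¹⁰ ≥ K⁹`. [folklore] -/
theorem exponent_late {K : ℝ} (hK : 16 ≤ K) :
    K ^ 9 - 1 ≤ K ^ 10 * (sqrt 2 + (sqrt K)⁻¹) ^ 2 / 2 - 1 - K ^ 10 := by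
  obtain ⟨hs0, hs4, hKs, h4, hKs2⟩ := invSqrt_facts hK
  set s := (sqrt K)⁻¹ with hs
  have hK0 : 0 < K := by linarith
  have h2 : sqrt 2 ^ 2 = 2 := sq_sqrt (by norm_num)
  have hexp : s ≤ (sqrt 2 + s) ^ 2 / 2 - 1 := by
    have : (sqrt 2 + s) ^ 2 = 2 + 2 * sqrt 2 * s + s ^ 2 := by ring_nf; rw [h2]; ring
    rw [this]
    have h1 : 1 ≤ sqrt 2 := by have := sqrt_two_gt; linarith
    nlinarith
  have hk9 : K ^ 9 ≤ K ^ 10 * s := by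
    have : K ^ 10 * s = K ^ 9 * (K * s) := by ring
    rw [this, hKs]
    have : K ^ 9 * 1 ≤ K ^ 9 * sqrt K := mul_le_mul_of_nonneg_left (by linarith) (by positivity)
    linarith
  have : K ^ 10 * s ≤ K ^ 10 * ((sqrt 2 + s) ^ 2 / 2 - 1) :=
    mul_le_mul_of_nonneg_left hexp (by positivity)
  linarith

/-- `2e·e^{-K⁹} < K⁻¹⁰` for `K ≥ 2` (since `e^{K⁹} ≥ K¹⁸/2`). [folklore] -/
theorem numeric_early {K : ℝ} (hK : 2 ≤ K) : 2 * exp (1 - K ^ 9) < 1 / K ^ 10 := by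
  have hK0 : 0 < K := by linarith
  have h8 : (2 : ℝ) ^ 8 ≤ K ^ 8 := pow_le_pow_left₀ (by norm_num) hK 8
  have he : exp 1 < 2.7182818286 := Real.exp_one_lt_d9
  have hexp : (K ^ 9) ^ 2 / 2 ≤ exp (K ^ 9) := by
    have := Real.pow_div_factorial_le_exp (x := K ^ 9) (hx := by positivity) (n := 2)
    simpa [Nat.factorial] using this
  have key : 2 * exp 1 * K ^ 10 < exp (K ^ 9) :=
    calc 2 * exp 1 * K ^ 10 < 2 * 2.7182818286 * K ^ 10 := by
          have : 0 < K ^ 10 := by positivity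
          nlinarith
      _ ≤ (K ^ 9) ^ 2 / 2 := by
          have h18 : (K ^ 9) ^ 2 = K ^ 8 * K ^ 10 := by ring
          rw [h18]
          nlinarith [pow_pos hK0 10]
      _ ≤ exp (K ^ 9) := hexp
  rw [Real.exp_sub, show 2 * (exp 1 / exp (K ^ 9)) = (2 * exp 1) / exp (K ^ 9) by ring,
    div_lt_div_iff₀ (exp_pos _) (by positivity), one_mul]
  exact key

/-- `K⁻¹⁰ < e^{K⁹-1}/(4K⁵)` for `K ≥ 2` (since `e^{K⁹-1} ≥ K⁹`). [folklore] -/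
theorem numeric_late {K : ℝ} (hK : 2 ≤ K) : 1 / K ^ 10 < 1 / (4 * K ^ 5) * exp (K ^ 9 - 1) := by
  have hK0 : 0 < K := by linarith
  have h4 : (2 : ℝ) ^ 4 ≤ K ^ 4 := pow_le_pow_left₀ (by norm_num) hK 4
  have hexp : K ^ 9 ≤ exp (K ^ 9 - 1) := by
    have := Real.add_one_le_exp (K ^ 9 - 1); linarith
  have h14 : (2 : ℝ) ^ 14 ≤ K ^ 14 := pow_le_pow_left₀ (by norm_num) hK 14
  rw [div_mul_eq_mul_div, one_mul, div_lt_div_iff₀ (by positivity) (by positivity), one_mul]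
  calc 4 * K ^ 5 < 2 ^ 14 * K ^ 5 := by nlinarith [pow_pos hK0 5]
    _ ≤ K ^ 14 * K ^ 5 := mul_le_mul_of_nonneg_right h14 (by positivity)
    _ = K ^ 9 * K ^ 10 := by ring
    _ ≤ exp (K ^ 9 - 1) * K ^ 10 := mul_le_mul_of_nonneg_right hexp (by positivity)

section CriticalTime

variable {K ε τ : ℝ} {X : ℝ → Fin 5 → ℝ}

/-- **(tcable) and (c-bound).** If `τ` is the first hitting time of the level `K⁻¹⁰ε²` by `c` on
`[0,2]`, then `√2 - 1/√K ≤ τ ≤ √2 + 1/√K` (in particular `1 ≤ τ < 7/4`) and `c(τ) = K⁻¹⁰ε²`.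
[cite: Tao2016AveragedNS, §5.5 (tcable), (c-bound)] -/
theorem tc_window (hX : ∀ t, HasDerivAt X (delayCircuit K ε (X t)) t) (h0 : X 0 = delayInit)
    (hε : 0 < ε) (hε1 : ε ≤ 1) (hK : 16 ≤ K) (hεK : ε ^ 2 ≤ 1 / (6 * K ^ 20))
    (hτ0 : 0 < τ) (hτ2 : τ ≤ 2)
    (hcτ : ∀ t, 0 ≤ t → t ≤ τ → X t 2 ≤ ε ^ 2 / K ^ 10)
    (hτeq : τ < 2 → X τ 2 = ε ^ 2 / K ^ 10) :
    sqrt 2 - (sqrt K)⁻¹ ≤ τ ∧ τ ≤ sqrt 2 + (sqrt K)⁻¹ ∧ 1 ≤ τ ∧ τ < 7 / 4 ∧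
      X τ 2 = ε ^ 2 / K ^ 10 := by
  obtain ⟨hs0, hs4, hKs, h4, hKs2⟩ := invSqrt_facts hK
  have hK2 : 2 ≤ K := by linarith
  have hK0 : 0 < K := by linarith
  have h72 := sqrt_two_gt
  have h71 := sqrt_two_lt
  -- early side
  have hearly : sqrt 2 - (sqrt K)⁻¹ ≤ τ := by
    by_contra hlt'
    have hlt := not_le.1 hlt'
    have hτlt2 : τ < 2 := by linarith
    have hcτeq := hτeq hτlt2
    have hup := c_upper_sharp hX h0 hε hε1 hK2 hτ2 hεK hcτ (t := τ) ⟨hτ0.le, le_rfl⟩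
    have hexpo := exponent_early hK hτ0.le hlt.le
    have hnum := numeric_early hK2
    have : X τ 2 < ε ^ 2 / K ^ 10 :=
      calc X τ 2 ≤ 2 * ε ^ 2 * exp (K ^ 10 * τ ^ 2 / 2 + 1 - K ^ 10) := hup
        _ ≤ 2 * ε ^ 2 * exp (1 - K ^ 9) :=
            mul_le_mul_of_nonneg_left (exp_le_exp.2 hexpo) (by positivity)
        _ = ε ^ 2 * (2 * exp (1 - K ^ 9)) := by ring
        _ < ε ^ 2 * (1 / K ^ 10) := mul_lt_mul_of_pos_left hnum (by positivity)
        _ = ε ^ 2 / K ^ 10 := by ring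
    exact absurd hcτeq this.ne
  have hτ1 : 1 ≤ τ := by linarith
  -- late side
  have hlate : τ ≤ sqrt 2 + (sqrt K)⁻¹ := by
    by_contra hlt'
    have hlt := not_le.1 hlt'
    set T := sqrt 2 + (sqrt K)⁻¹ with hT
    have hT5 : (K ^ 5)⁻¹ ≤ T := by
      have : (K ^ 5)⁻¹ ≤ 1 := inv_le_one_of_one_le₀ (one_le_pow₀ (by linarith))
      linarith
    have hτ5 : (K ^ 5)⁻¹ ≤ τ := by linarith
    have hlow := c_lower_sharp hX h0 hε hε1 hK2 hτ2 hτ5 hεK hcτ (t := T) ⟨hT5, hlt.le⟩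
    have hcT : X T 2 ≤ ε ^ 2 / K ^ 10 := hcτ T (by linarith) hlt.le
    have hexpo := exponent_late hK
    have hnum := numeric_late hK2
    have : ε ^ 2 / K ^ 10 < X T 2 :=
      calc ε ^ 2 / K ^ 10 = ε ^ 2 * (1 / K ^ 10) := by ring
        _ < ε ^ 2 * (1 / (4 * K ^ 5) * exp (K ^ 9 - 1)) := mul_lt_mul_of_pos_left hnum (by positivity)
        _ = ε ^ 2 / (4 * K ^ 5) * exp (K ^ 9 - 1) := by ring
        _ ≤ ε ^ 2 / (4 * K ^ 5) * exp (K ^ 10 * T ^ 2 / 2 - 1 - K ^ 10) :=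
            mul_le_mul_of_nonneg_left (exp_le_exp.2 hexpo) (by positivity)
        _ ≤ X T 2 := hlow
    exact absurd hcT (not_le.2 this)
  have hτ74 : τ < 7 / 4 := by linarith
  exact ⟨hearly, hlate, hτ1, hτ74, hτeq (by linarith)⟩

end CriticalTime


section PhaseTwo

/-! ## After the critical time: `b ≳ ε`, (c-large), (cgrow-2) -/

variable {K ε τ : ℝ} {X : ℝ → Fin 5 → ℝ}

/-- `b ≥ ε/8` on `[τ,2]` ("`b(t) ≳ ε` for `t ∈ [t_c,2]`", from (bogo-2) at `t_c` and
`∂ₜb ≥ -ε³exp(O(K¹⁰))`). [cite: Tao2016AveragedNS, §5.5 proof] -/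
theorem b_lower_after (hX : ∀ t, HasDerivAt X (delayCircuit K ε (X t)) t) (h0 : X 0 = delayInit)
    (hε : 0 < ε) (hε1 : ε ≤ 1) (hK : 16 ≤ K) (hεK : ε ^ 2 ≤ 1 / (6 * K ^ 20))
    (hεexp : ε ^ 2 ≤ exp (-(18 * K ^ 10)) / (64 * K ^ 10))
    (hτ1 : 1 ≤ τ) (hτ2 : τ ≤ 2)
    (hcτ : ∀ t, 0 ≤ t → t ≤ τ → X t 2 ≤ ε ^ 2 / K ^ 10)
    {t : ℝ} (ht : t ∈ Icc τ 2) : ε / 8 ≤ X t 1 := by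
  have hK0 : 0 < K := by linarith
  have hK1 : 1 ≤ K := by linarith
  set k : ℝ := K ^ 10 with hk
  have hk0 : 0 < k := by positivity
  -- `b(τ) ≥ ε/2`
  have hbτ : ε / 2 ≤ X τ 1 := by
    have hb := b_linear hX h0 hε hε1 hK1 hτ2 hεK hcτ (t := τ) ⟨by linarith, le_rfl⟩
    have h1 := (abs_le.1 hb).1
    have hK20 : 34 / K ^ 20 ≤ 1 / 2 := by
      rw [div_le_div_iff₀ (by positivity) (by norm_num)]
      have : (2 : ℝ) ^ 20 ≤ K ^ 20 := pow_le_pow_left₀ (by norm_num) (by linarith) 20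
      nlinarith
    have h2 : 17 * ε / K ^ 20 * τ ≤ 34 / K ^ 20 * ε := by
      have : 17 * ε / K ^ 20 * τ ≤ 17 * ε / K ^ 20 * 2 :=
        mul_le_mul_of_nonneg_left hτ2 (by positivity)
      have h2e : 17 * ε / K ^ 20 * 2 = 34 / K ^ 20 * ε := by ring
      linarith
    have h3 : 34 / K ^ 20 * ε ≤ 1 / 2 * ε := mul_le_mul_of_nonneg_right hK20 hε.le
    nlinarith
  -- `∂ₜb ≥ -ε/16` on `[τ,2]`
  have hmono := monotoneOn_sub_of_le_deriv (φ := fun _ => -(ε / 16))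
    (Φ := fun s => -(ε / 16) * s) (convex_Icc τ 2) (fun s _ => hasDerivAt_b hX s)
    (fun s _ => ((hasDerivAt_id s).const_mul (-(ε / 16))).congr_deriv (by simp))
    (fun s hs => by
      have hs02 : s ∈ Icc (0 : ℝ) 2 := ⟨by linarith [hs.1], hs.2⟩
      have hc0 : 0 ≤ X s 2 := c_nonneg hX h0 hs02.1
      have hcc : X s 2 ≤ 2 * ε ^ 2 * exp ((5 * s - 1) * K ^ 10) := c_crude hX h0 hε hε1 hs02
      have hc9 : X s 2 ≤ 2 * ε ^ 2 * exp (9 * k) := by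
        refine hcc.trans (mul_le_mul_of_nonneg_left (exp_le_exp.2 ?_) (by positivity))
        simp only [hk]; nlinarith [hs.2]
      have hc2 : X s 2 ^ 2 ≤ (2 * ε ^ 2 * exp (9 * k)) ^ 2 := pow_le_pow_left₀ hc0 hc9 2
      -- `ν c² ≤ 4 k ε³ e^{18k} ≤ ε/16`
      have hνc : ε⁻¹ * K ^ 10 * X s 2 ^ 2 ≤ ε / 16 := by
        have hε2 : ε ^ 2 * exp (18 * k) ≤ 1 / (64 * k) := by
          have := hεexp
          rw [show -(18 * K ^ 10) = -(18 * k) by simp [hk], show 64 * K ^ 10 = 64 * k by simp [hk]]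
            at this
          calc ε ^ 2 * exp (18 * k) ≤ exp (-(18 * k)) / (64 * k) * exp (18 * k) :=
                mul_le_mul_of_nonneg_right this (exp_pos _).le
            _ = 1 / (64 * k) := by
                rw [div_mul_eq_mul_div, mul_comm (exp _) (exp _), ← exp_add, add_neg_cancel,
                  exp_zero]
        calc ε⁻¹ * K ^ 10 * X s 2 ^ 2 ≤ ε⁻¹ * K ^ 10 * (2 * ε ^ 2 * exp (9 * k)) ^ 2 :=
              mul_le_mul_of_nonneg_left hc2 (by positivity)
          _ = 4 * k * ε * (ε ^ 2 * exp (18 * k)) := by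
              simp only [hk]
              rw [show (18 : ℝ) * K ^ 10 = 9 * K ^ 10 + 9 * K ^ 10 by ring, exp_add]
              field_simp
              ring
          _ ≤ 4 * k * ε * (1 / (64 * k)) := mul_le_mul_of_nonneg_left hε2 (by positivity)
          _ = ε / 16 := by field_simp; ring
      have ha2 : 0 ≤ ε * X s 0 ^ 2 := by positivity
      linarith)
  have hτmem : τ ∈ Icc τ 2 := ⟨le_rfl, hτ2⟩
  have h := hmono hτmem ht ht.1
  simp only at h
  have : t - τ ≤ 1 := by linarith [ht.2]
  nlinarith

/-- Exponential growth after `t_c`: `c(t) ≥ K⁻¹⁰ε² exp(K¹⁰(t-τ)/8)` on `[τ,2]` (from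
`∂ₜc ≳ K¹⁰c`). [cite: Tao2016AveragedNS, §5.5 (c-large)] -/
theorem c_growth (hX : ∀ t, HasDerivAt X (delayCircuit K ε (X t)) t) (h0 : X 0 = delayInit)
    (hε : 0 < ε) (hε1 : ε ≤ 1) (hK : 16 ≤ K) (hεK : ε ^ 2 ≤ 1 / (6 * K ^ 20))
    (hεexp : ε ^ 2 ≤ exp (-(18 * K ^ 10)) / (64 * K ^ 10))
    (hτ1 : 1 ≤ τ) (hτ2 : τ ≤ 2)
    (hcτ : ∀ t, 0 ≤ t → t ≤ τ → X t 2 ≤ ε ^ 2 / K ^ 10) (hcτeq : X τ 2 = ε ^ 2 / K ^ 10)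
    {t : ℝ} (ht : t ∈ Icc τ 2) :
    ε ^ 2 / K ^ 10 * exp (K ^ 10 * (t - τ) / 8) ≤ X t 2 := by
  have hK0 : 0 < K := by linarith
  set k : ℝ := K ^ 10 with hk
  have hmono := monotoneOn_intFactor (s := Icc τ 2) (g := fun _ => k / 8)
    (G := fun s => k / 8 * s) (φ := fun _ => 0) (Φ := fun _ => 0) (convex_Icc τ 2)
    (fun s _ => hasDerivAt_c hX s)
    (fun s _ => ((hasDerivAt_id s).const_mul (k / 8)).congr_deriv (by simp))
    (fun s _ => hasDerivAt_const s (0 : ℝ))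
    (fun s hs => by
      have hc0 : 0 ≤ X s 2 := c_nonneg hX h0 (by linarith [hs.1])
      have hb : ε / 8 ≤ X s 1 := b_lower_after hX h0 hε hε1 hK hεK hεexp hτ1 hτ2 hcτ hs
      have hνb : k / 8 ≤ ε⁻¹ * K ^ 10 * X s 1 := by
        calc k / 8 = ε⁻¹ * K ^ 10 * (ε / 8) := by simp only [hk]; field_simp
          _ ≤ ε⁻¹ * K ^ 10 * X s 1 := mul_le_mul_of_nonneg_left hb (by positivity)
      have h1 : k / 8 * X s 2 ≤ ε⁻¹ * K ^ 10 * X s 1 * X s 2 :=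
        mul_le_mul_of_nonneg_right hνb hc0
      have h2 : 0 ≤ ε ^ 2 * exp (-K ^ 10) * X s 0 ^ 2 := by positivity
      have : 0 ≤ ε ^ 2 * exp (-K ^ 10) * X s 0 ^ 2 + ε⁻¹ * K ^ 10 * X s 1 * X s 2
          - k / 8 * X s 2 := by linarith
      exact mul_nonneg this (exp_pos _).le)
  have hτmem : τ ∈ Icc τ 2 := ⟨le_rfl, hτ2⟩
  have h := hmono hτmem ht ht.1
  simp only [sub_zero, hcτeq] at h
  have hE : X t 2 = X t 2 * exp (-(k / 8 * t)) * exp (k / 8 * t) := by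
    rw [mul_assoc, ← exp_add, neg_add_cancel, exp_zero, mul_one]
  rw [hE]
  calc ε ^ 2 / K ^ 10 * exp (K ^ 10 * (t - τ) / 8)
      = ε ^ 2 / K ^ 10 * exp (-(k / 8 * τ)) * exp (k / 8 * t) := by
        rw [mul_assoc, ← exp_add]; congr 2; simp only [hk]; ring
    _ ≤ X t 2 * exp (-(k / 8 * t)) * exp (k / 8 * t) :=
        mul_le_mul_of_nonneg_right h (exp_pos _).le

/-- (c-large): `c ≥ K¹⁰⁰ε²` on `I = [τ + K⁻⁹, 2]` ("the rotor gate will be continuously and strongly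
activated from time `t_c + K⁻⁹` onwards"), given `e^{K/8} ≥ K¹¹⁰`.
[cite: Tao2016AveragedNS, §5.5 (c-large)] -/
theorem c_large (hX : ∀ t, HasDerivAt X (delayCircuit K ε (X t)) t) (h0 : X 0 = delayInit)
    (hε : 0 < ε) (hε1 : ε ≤ 1) (hK : 16 ≤ K) (hεK : ε ^ 2 ≤ 1 / (6 * K ^ 20))
    (hεexp : ε ^ 2 ≤ exp (-(18 * K ^ 10)) / (64 * K ^ 10)) (hN3 : K ^ 110 ≤ exp (K / 8))
    (hτ1 : 1 ≤ τ) (hτ2 : τ ≤ 2)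
    (hcτ : ∀ t, 0 ≤ t → t ≤ τ → X t 2 ≤ ε ^ 2 / K ^ 10) (hcτeq : X τ 2 = ε ^ 2 / K ^ 10)
    {t : ℝ} (ht : t ∈ Icc (τ + (K ^ 9)⁻¹) 2) : K ^ 100 * ε ^ 2 ≤ X t 2 := by
  have hK0 : 0 < K := by linarith
  have ht' : t ∈ Icc τ 2 := ⟨by linarith [ht.1, inv_pos.2 (pow_pos hK0 9)], ht.2⟩
  have hg := c_growth hX h0 hε hε1 hK hεK hεexp hτ1 hτ2 hcτ hcτeq ht'
  have hexp : K / 8 ≤ K ^ 10 * (t - τ) / 8 := by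
    have h1 : (K ^ 9)⁻¹ ≤ t - τ := by linarith [ht.1]
    have : K ^ 10 * (K ^ 9)⁻¹ = K := by field_simp
    have h2 : K ^ 10 * (K ^ 9)⁻¹ ≤ K ^ 10 * (t - τ) := mul_le_mul_of_nonneg_left h1 (by positivity)
    linarith
  calc K ^ 100 * ε ^ 2 = ε ^ 2 / K ^ 10 * K ^ 110 := by field_simp
    _ ≤ ε ^ 2 / K ^ 10 * exp (K / 8) := mul_le_mul_of_nonneg_left hN3 (by positivity)
    _ ≤ ε ^ 2 / K ^ 10 * exp (K ^ 10 * (t - τ) / 8) :=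
        mul_le_mul_of_nonneg_left (exp_le_exp.2 hexp) (by positivity)
    _ ≤ X t 2 := hg

/-- (cgrow-2): on `I`, `0 ≤ ∂ₜc ≤ 6K¹⁰c`. [cite: Tao2016AveragedNS, §5.5 (cgrow-2)] -/
theorem c_deriv_bounds (hX : ∀ t, HasDerivAt X (delayCircuit K ε (X t)) t) (h0 : X 0 = delayInit)
    (hε : 0 < ε) (hε1 : ε ≤ 1) (hK : 16 ≤ K) (hεK : ε ^ 2 ≤ 1 / (6 * K ^ 20))
    (hεexp : ε ^ 2 ≤ exp (-(18 * K ^ 10)) / (64 * K ^ 10)) (hN3 : K ^ 110 ≤ exp (K / 8))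
    (hτ1 : 1 ≤ τ) (hτ2 : τ ≤ 2)
    (hcτ : ∀ t, 0 ≤ t → t ≤ τ → X t 2 ≤ ε ^ 2 / K ^ 10) (hcτeq : X τ 2 = ε ^ 2 / K ^ 10)
    {t : ℝ} (ht : t ∈ Icc (τ + (K ^ 9)⁻¹) 2) :
    0 ≤ ε ^ 2 * exp (-K ^ 10) * X t 0 ^ 2 + ε⁻¹ * K ^ 10 * X t 1 * X t 2 ∧
      ε ^ 2 * exp (-K ^ 10) * X t 0 ^ 2 + ε⁻¹ * K ^ 10 * X t 1 * X t 2 ≤ 6 * K ^ 10 * X t 2 := by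
  have hK0 : 0 < K := by linarith
  have ht' : t ∈ Icc τ 2 := ⟨by linarith [ht.1, inv_pos.2 (pow_pos hK0 9)], ht.2⟩
  have ht02 : t ∈ Icc (0 : ℝ) 2 := ⟨by linarith [ht'.1], ht.2⟩
  have hc0 : 0 ≤ X t 2 := c_nonneg hX h0 ht02.1
  have hcl : K ^ 100 * ε ^ 2 ≤ X t 2 := c_large hX h0 hε hε1 hK hεK hεexp hN3 hτ1 hτ2 hcτ hcτeq ht
  have hb : ε / 8 ≤ X t 1 := b_lower_after hX h0 hε hε1 hK hεK hεexp hτ1 hτ2 hcτ ht'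
  have hb5 : |X t 1| ≤ 5 * ε := (bc_small hX h0 hε hε1 ht02).1
  have ha : X t 0 ^ 2 ≤ 1 := traj_sq_le_one hX h0 t 0
  constructor
  · have h1 : 0 ≤ ε⁻¹ * K ^ 10 * X t 1 * X t 2 := by
      have : 0 ≤ X t 1 := by linarith [hε.le]
      positivity
    positivity
  · -- `μ a² ≤ ε² ≤ K¹⁰⁰ ε² ≤ c ≤ K¹⁰ c` and `ν b c ≤ 5 K¹⁰ c`
    have hek : exp (-K ^ 10) ≤ 1 := by rw [exp_le_one_iff, neg_nonpos]; positivity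
    have h1 : ε ^ 2 * exp (-K ^ 10) * X t 0 ^ 2 ≤ K ^ 10 * X t 2 := by
      calc ε ^ 2 * exp (-K ^ 10) * X t 0 ^ 2 ≤ ε ^ 2 * 1 * 1 :=
            mul_le_mul (mul_le_mul_of_nonneg_left hek (by positivity)) ha (by positivity)
              (by positivity)
        _ ≤ K ^ 100 * ε ^ 2 := by
            have : (1 : ℝ) ≤ K ^ 100 := one_le_pow₀ (by linarith)
            nlinarith [pow_pos hε 2]
        _ ≤ X t 2 := hcl
        _ ≤ K ^ 10 * X t 2 := by
            have : (1 : ℝ) ≤ K ^ 10 := one_le_pow₀ (by linarith)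
            nlinarith
    have h2 : ε⁻¹ * K ^ 10 * X t 1 * X t 2 ≤ 5 * K ^ 10 * X t 2 := by
      have hb' : X t 1 ≤ 5 * ε := (le_abs_self _).trans hb5
      have h5 : ε⁻¹ * X t 1 ≤ 5 := by rw [inv_mul_le_iff₀ hε]; linarith
      have : ε⁻¹ * K ^ 10 * X t 1 * X t 2 = (ε⁻¹ * X t 1) * (K ^ 10 * X t 2) := by ring
      rw [this]
      have hkc : 0 ≤ K ^ 10 * X t 2 := by positivity
      nlinarith
    linarith

/-! ## Equipartition: the corrector `V = a d ε²/c` and (douse) -/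

/-- The equipartition corrector `V = a·d·ε²/c` has `∂ₜV = (a² - d²) + R` with the explicit
remainder `R = -(εabd + μacd + Kadã)ε²/c - ad(ε²/c)(∂ₜc/c)` (product rule; the rotor terms give
exactly `ε⁻²c·(a²-d²)·ε²/c = a² - d²`). [cite: Tao2016AveragedNS, §5.5 (douse)] -/
theorem hasDerivAt_V (hX : ∀ t, HasDerivAt X (delayCircuit K ε (X t)) t) (hε : ε ≠ 0)
    {t : ℝ} (hc : X t 2 ≠ 0) :
    HasDerivAt (fun s => X s 0 * X s 3 * (ε ^ 2 * (X s 2)⁻¹))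
      ((X t 0 ^ 2 - X t 3 ^ 2) +
        (-(ε * X t 0 * X t 1 * X t 3 + ε ^ 2 * exp (-K ^ 10) * X t 0 * X t 2 * X t 3
            + K * X t 0 * X t 3 * X t 4) * (ε ^ 2 * (X t 2)⁻¹)
          - X t 0 * X t 3 * (ε ^ 2 * (X t 2)⁻¹) *
            ((ε ^ 2 * exp (-K ^ 10) * X t 0 ^ 2 + ε⁻¹ * K ^ 10 * X t 1 * X t 2) * (X t 2)⁻¹))) t := by
  have h1 := (hasDerivAt_a hX t).fun_mul (hasDerivAt_d hX t)
  have h2 := ((hasDerivAt_c hX t).fun_inv hc).const_mul (ε ^ 2)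
  refine (h1.fun_mul h2).congr_deriv ?_
  field_simp
  ring

/-- Size of the remainder in `∂ₜV` on `I`: `|R| ≤ 9K⁻⁹⁰` (uses `ε²/c ≤ K⁻¹⁰⁰`, `0 ≤ ∂ₜc ≤ 6K¹⁰c`,
all modes `O(1)`). [cite: Tao2016AveragedNS, §5.5 (douse)] -/
theorem V_remainder_le (hX : ∀ t, HasDerivAt X (delayCircuit K ε (X t)) t) (h0 : X 0 = delayInit)
    (hε : 0 < ε) (hε1 : ε ≤ 1) (hK : 16 ≤ K) (hεK : ε ^ 2 ≤ 1 / (6 * K ^ 20))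
    (hεexp : ε ^ 2 ≤ exp (-(18 * K ^ 10)) / (64 * K ^ 10)) (hN3 : K ^ 110 ≤ exp (K / 8))
    (hτ1 : 1 ≤ τ) (hτ2 : τ ≤ 2)
    (hcτ : ∀ t, 0 ≤ t → t ≤ τ → X t 2 ≤ ε ^ 2 / K ^ 10) (hcτeq : X τ 2 = ε ^ 2 / K ^ 10)
    {t : ℝ} (ht : t ∈ Icc (τ + (K ^ 9)⁻¹) 2) :
    |(-(ε * X t 0 * X t 1 * X t 3 + ε ^ 2 * exp (-K ^ 10) * X t 0 * X t 2 * X t 3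
            + K * X t 0 * X t 3 * X t 4) * (ε ^ 2 * (X t 2)⁻¹)
          - X t 0 * X t 3 * (ε ^ 2 * (X t 2)⁻¹) *
            ((ε ^ 2 * exp (-K ^ 10) * X t 0 ^ 2 + ε⁻¹ * K ^ 10 * X t 1 * X t 2) * (X t 2)⁻¹))|
      ≤ 9 / K ^ 90 := by
  have hK0 : 0 < K := by linarith
  have hK1 : 1 ≤ K := by linarith
  have hcl : K ^ 100 * ε ^ 2 ≤ X t 2 := c_large hX h0 hε hε1 hK hεK hεexp hN3 hτ1 hτ2 hcτ hcτeq ht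
  have hcpos : 0 < X t 2 := lt_of_lt_of_le (by positivity) hcl
  obtain ⟨hc'0, hc'6⟩ := c_deriv_bounds hX h0 hε hε1 hK hεK hεexp hN3 hτ1 hτ2 hcτ hcτeq ht
  set q : ℝ := ε ^ 2 * (X t 2)⁻¹ with hq
  have hq0 : 0 ≤ q := by positivity
  have hq1 : q ≤ 1 / K ^ 100 := by
    simp only [hq]
    rw [← div_eq_mul_inv, div_le_div_iff₀ hcpos (by positivity), one_mul]
    linarith
  set c' : ℝ := ε ^ 2 * exp (-K ^ 10) * X t 0 ^ 2 + ε⁻¹ * K ^ 10 * X t 1 * X t 2 with hc'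
  have hrat0 : 0 ≤ c' * (X t 2)⁻¹ := by positivity
  have hrat : c' * (X t 2)⁻¹ ≤ 6 * K ^ 10 := by
    rw [← div_eq_mul_inv, div_le_iff₀ hcpos]; exact hc'6
  have ha : |X t 0| ≤ 1 := traj_abs_le_one hX h0 t 0
  have hb : |X t 1| ≤ 1 := traj_abs_le_one hX h0 t 1
  have hc : |X t 2| ≤ 1 := traj_abs_le_one hX h0 t 2
  have hd : |X t 3| ≤ 1 := traj_abs_le_one hX h0 t 3
  have he : |X t 4| ≤ 1 := traj_abs_le_one hX h0 t 4
  have hμ1 : ε ^ 2 * exp (-K ^ 10) ≤ 1 := by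
    have hek : exp (-K ^ 10) ≤ 1 := by rw [exp_le_one_iff, neg_nonpos]; positivity
    calc ε ^ 2 * exp (-K ^ 10) ≤ 1 ^ 2 * 1 :=
          mul_le_mul (pow_le_pow_left₀ hε.le hε1 2) hek (exp_pos _).le (by positivity)
      _ = 1 := by ring
  -- term 1
  have hT1 : |(-(ε * X t 0 * X t 1 * X t 3 + ε ^ 2 * exp (-K ^ 10) * X t 0 * X t 2 * X t 3
      + K * X t 0 * X t 3 * X t 4) * q)| ≤ (2 + K) * (1 / K ^ 100) := by
    rw [abs_mul, abs_neg, abs_of_nonneg hq0]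
    have hin : |ε * X t 0 * X t 1 * X t 3 + ε ^ 2 * exp (-K ^ 10) * X t 0 * X t 2 * X t 3
        + K * X t 0 * X t 3 * X t 4| ≤ 2 + K := by
      have e1 : |ε * X t 0 * X t 1 * X t 3| ≤ 1 := by
        rw [abs_mul, abs_mul, abs_mul, abs_of_pos hε]
        calc ε * |X t 0| * |X t 1| * |X t 3| ≤ 1 * 1 * 1 * 1 := by
              gcongr
          _ = 1 := by ring
      have e2 : |ε ^ 2 * exp (-K ^ 10) * X t 0 * X t 2 * X t 3| ≤ 1 := by
        rw [abs_mul, abs_mul, abs_mul, abs_of_nonneg (by positivity : 0 ≤ ε ^ 2 * exp (-K ^ 10))]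
        calc ε ^ 2 * exp (-K ^ 10) * |X t 0| * |X t 2| * |X t 3| ≤ 1 * 1 * 1 * 1 := by
              gcongr
          _ = 1 := by ring
      have e3 : |K * X t 0 * X t 3 * X t 4| ≤ K := by
        rw [abs_mul, abs_mul, abs_mul, abs_of_pos hK0]
        calc K * |X t 0| * |X t 3| * |X t 4| ≤ K * 1 * 1 * 1 := by gcongr
          _ = K := by ring
      calc _ ≤ |ε * X t 0 * X t 1 * X t 3 + ε ^ 2 * exp (-K ^ 10) * X t 0 * X t 2 * X t 3|
            + |K * X t 0 * X t 3 * X t 4| := abs_add_le _ _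
        _ ≤ |ε * X t 0 * X t 1 * X t 3| + |ε ^ 2 * exp (-K ^ 10) * X t 0 * X t 2 * X t 3|
            + |K * X t 0 * X t 3 * X t 4| := by
            have := abs_add_le (ε * X t 0 * X t 1 * X t 3)
              (ε ^ 2 * exp (-K ^ 10) * X t 0 * X t 2 * X t 3)
            linarith
        _ ≤ 2 + K := by linarith
    exact mul_le_mul hin hq1 hq0 (by positivity)
  -- term 2
  have hT2 : |X t 0 * X t 3 * q * (c' * (X t 2)⁻¹)| ≤ 6 * K ^ 10 * (1 / K ^ 100) := by
    rw [abs_mul, abs_mul, abs_mul, abs_of_nonneg hq0, abs_of_nonneg hrat0]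
    calc |X t 0| * |X t 3| * q * (c' * (X t 2)⁻¹) ≤ 1 * 1 * (1 / K ^ 100) * (6 * K ^ 10) := by
          gcongr
      _ = 6 * K ^ 10 * (1 / K ^ 100) := by ring
  have hsum : (2 + K) * (1 / K ^ 100) + 6 * K ^ 10 * (1 / K ^ 100) ≤ 9 / K ^ 90 := by
    have h10 : 2 + K ≤ 3 * K ^ 10 := by
      have : K ≤ K ^ 10 := le_self_pow₀ hK1 (by norm_num)
      linarith
    rw [show 9 / K ^ 90 = 9 * K ^ 10 * (1 / K ^ 100) by field_simp]
    have : 0 ≤ 1 / K ^ 100 := by positivity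
    nlinarith
  calc _ ≤ |(-(ε * X t 0 * X t 1 * X t 3 + ε ^ 2 * exp (-K ^ 10) * X t 0 * X t 2 * X t 3
        + K * X t 0 * X t 3 * X t 4) * q)| + |X t 0 * X t 3 * q * (c' * (X t 2)⁻¹)| :=
        abs_sub _ _
    _ ≤ (2 + K) * (1 / K ^ 100) + 6 * K ^ 10 * (1 / K ^ 100) := add_le_add hT1 hT2
    _ ≤ 9 / K ^ 90 := hsum

end PhaseTwo


section PhaseThree

/-! ## The claim (atc): `ã(t_c + 1/K) ≥ 1/10` -/

variable {K ε τ : ℝ} {X : ℝ → Fin 5 → ℝ}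

/-- **(atc)**: `ã(t_c + 1/K) ≥ 1/10`. If not, on `J = [t_c + K⁻⁹, t_c + 1/K]` one has `ã ≤ 1/10`,
hence `a² + d² ≥ 0.98`, while `Ψ = V + 2ã/K` has `∂ₜΨ = a² + d² + O(K⁻⁹⁰)` and total variation
`≤ 2K⁻¹⁰⁰ + 0.2/K` over `J` — a contradiction. [cite: Tao2016AveragedNS, §5.5 (atc)] -/
theorem e_tenth (hX : ∀ t, HasDerivAt X (delayCircuit K ε (X t)) t) (h0 : X 0 = delayInit)
    (hε : 0 < ε) (hε1 : ε ≤ 1) (hK : 16 ≤ K) (hεK : ε ^ 2 ≤ 1 / (6 * K ^ 20))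
    (hεexp : ε ^ 2 ≤ exp (-(18 * K ^ 10)) / (64 * K ^ 10)) (hN3 : K ^ 110 ≤ exp (K / 8))
    (hτ1 : 1 ≤ τ) (hτ74 : τ < 7 / 4)
    (hcτ : ∀ t, 0 ≤ t → t ≤ τ → X t 2 ≤ ε ^ 2 / K ^ 10) (hcτeq : X τ 2 = ε ^ 2 / K ^ 10) :
    1 / 10 ≤ X (τ + K⁻¹) 4 := by
  have hK0 : 0 < K := by linarith
  have hK1 : 1 ≤ K := by linarith
  have hτ2 : τ ≤ 2 := by linarith
  set t₀ : ℝ := τ + (K ^ 9)⁻¹ with ht₀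
  set t₁ : ℝ := τ + K⁻¹ with ht₁
  have hK9 : (K ^ 9)⁻¹ ≤ K⁻¹ := by
    rw [inv_le_inv₀ (by positivity) hK0]; exact le_self_pow₀ hK1 (by norm_num)
  have hKinv : K⁻¹ ≤ 1 / 16 := by rw [inv_le_comm₀ hK0 (by norm_num)]; linarith
  have h01 : t₀ ≤ t₁ := by simp only [ht₀, ht₁]; linarith
  have ht12 : t₁ ≤ 2 := by simp only [ht₁]; linarith
  have hJI : ∀ s ∈ Icc t₀ t₁, s ∈ Icc (τ + (K ^ 9)⁻¹) 2 := fun s hs => ⟨hs.1, hs.2.trans ht12⟩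
  -- numeric facts
  have hK20 : (2 : ℝ) ^ 20 ≤ K ^ 20 := pow_le_pow_left₀ (by norm_num) (by linarith) 20
  have hK90 : (2 : ℝ) ^ 90 ≤ K ^ 90 := pow_le_pow_left₀ (by norm_num) (by linarith) 90
  have hε2 : (5 * ε) ^ 2 ≤ 1 / 1000 := by
    have h6 : 1 / (6 * K ^ 20) ≤ 1 / 25000 := by
      apply one_div_le_one_div_of_le (by norm_num); linarith
    have : (5 * ε) ^ 2 = 25 * ε ^ 2 := by ring
    rw [this]; linarith
  have hK90' : 9 / K ^ 90 ≤ 1 / 1000 := by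
    rw [div_le_div_iff₀ (by positivity) (by norm_num)]; linarith
  by_contra hlt'
  have hlt := not_le.1 hlt'
  have hmonoE := delayCircuit_output_monotone hK0.le hX
  -- `Ψ = V + (2/K) ã` has derivative `≥ 0.97` on `J`
  have hmono := monotoneOn_sub_of_le_deriv (φ := fun _ => (97 : ℝ) / 100)
    (Φ := fun s => 97 / 100 * s) (convex_Icc t₀ t₁)
    (f := fun s => X s 0 * X s 3 * (ε ^ 2 * (X s 2)⁻¹) + 2 / K * X s 4)
    (fun s hs => by
      have hsI := hJI s hs
      have hcl : K ^ 100 * ε ^ 2 ≤ X s 2 :=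
        c_large hX h0 hε hε1 hK hεK hεexp hN3 hτ1 hτ2 hcτ hcτeq hsI
      have hcne : X s 2 ≠ 0 := (lt_of_lt_of_le (by positivity) hcl).ne'
      exact (hasDerivAt_V hX hε.ne' hcne).add ((hasDerivAt_e hX s).const_mul (2 / K)))
    (fun s _ => ((hasDerivAt_id s).const_mul ((97 : ℝ) / 100)).congr_deriv (by simp))
    (fun s hs => by
      have hsI := hJI s hs
      have hs02 : s ∈ Icc (0 : ℝ) 2 := ⟨by linarith [hs.1, inv_pos.2 (pow_pos hK0 9)], hsI.2⟩
      have hR := V_remainder_le hX h0 hε hε1 hK hεK hεexp hN3 hτ1 hτ2 hcτ hcτeq hsI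
      have hRlo := (abs_le.1 hR).1
      have hsum := traj_sum_sq_eq_one hX h0 s
      obtain ⟨hb5, hc5⟩ := bc_small hX h0 hε hε1 hs02
      have hb2 : X s 1 ^ 2 ≤ (5 * ε) ^ 2 := by
        rw [← sq_abs]; exact pow_le_pow_left₀ (abs_nonneg _) hb5 2
      have hc2 : X s 2 ^ 2 ≤ (5 * ε) ^ 2 := by
        rw [← sq_abs]; exact pow_le_pow_left₀ (abs_nonneg _) hc5 2
      have hes : X s 4 ≤ 1 / 10 := (hmonoE hs.2).trans hlt.le
      have hes0 : 0 ≤ X s 4 := e_nonneg hX h0 hK0.le hs02.1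
      have he2 : X s 4 ^ 2 ≤ 1 / 100 := by
        have := pow_le_pow_left₀ hes0 hes 2; norm_num at this; exact this
      have hKd : 2 / K * (K * X s 3 ^ 2) = 2 * X s 3 ^ 2 := by field_simp
      rw [hKd]
      linarith)
  have hmem0 : t₀ ∈ Icc t₀ t₁ := ⟨le_rfl, h01⟩
  have hmem1 : t₁ ∈ Icc t₀ t₁ := ⟨h01, le_rfl⟩
  have h := hmono hmem0 hmem1 h01
  simp only at h
  -- sizes of `V` at the endpoints and of `ã`
  have hV : ∀ s ∈ Icc t₀ t₁, |X s 0 * X s 3 * (ε ^ 2 * (X s 2)⁻¹)| ≤ 1 / K ^ 100 := by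
    intro s hs
    have hsI := hJI s hs
    have hcl : K ^ 100 * ε ^ 2 ≤ X s 2 :=
      c_large hX h0 hε hε1 hK hεK hεexp hN3 hτ1 hτ2 hcτ hcτeq hsI
    have hcpos : 0 < X s 2 := lt_of_lt_of_le (by positivity) hcl
    have hq0 : 0 ≤ ε ^ 2 * (X s 2)⁻¹ := by positivity
    have hq : ε ^ 2 * (X s 2)⁻¹ ≤ 1 / K ^ 100 := by
      rw [← div_eq_mul_inv, div_le_div_iff₀ hcpos (by positivity), one_mul]; linarith
    rw [abs_mul, abs_mul, abs_of_nonneg hq0]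
    calc |X s 0| * |X s 3| * (ε ^ 2 * (X s 2)⁻¹) ≤ 1 * 1 * (1 / K ^ 100) :=
          mul_le_mul (mul_le_mul (traj_abs_le_one hX h0 s 0) (traj_abs_le_one hX h0 s 3) (abs_nonneg _)
            zero_le_one) hq hq0 (by norm_num)
      _ = 1 / K ^ 100 := by ring
  have hV0 := (abs_le.1 (hV t₀ hmem0)).1
  have hV1 := (abs_le.1 (hV t₁ hmem1)).2
  have he0 : 0 ≤ X t₀ 4 := e_nonneg hX h0 hK0.le (by simp only [ht₀]; positivity)
  have hlen : t₁ - t₀ = K⁻¹ - (K ^ 9)⁻¹ := by simp only [ht₀, ht₁]; ring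
  -- numeric contradiction, in the variable `u = 1/K`
  set u : ℝ := K⁻¹ with hu
  have hu0 : 0 < u := by positivity
  have hK8 : (2 : ℝ) ^ 8 ≤ K ^ 8 := pow_le_pow_left₀ (by norm_num) (by linarith) 8
  have hK99 : (2 : ℝ) ^ 8 ≤ K ^ 99 := hK8.trans (pow_le_pow_right₀ hK1 (by norm_num))
  have hi8 : (K ^ 8)⁻¹ ≤ 1 / 256 := by
    rw [one_div, inv_le_inv₀ (by positivity) (by norm_num)]; linarith
  have hi99 : (K ^ 99)⁻¹ ≤ 1 / 256 := by
    rw [one_div, inv_le_inv₀ (by positivity) (by norm_num)]; linarith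
  have h9 : (K ^ 9)⁻¹ ≤ u * (1 / 256) := by
    rw [show (K ^ 9)⁻¹ = u * (K ^ 8)⁻¹ by simp only [hu]; rw [← mul_inv, ← pow_succ']]
    exact mul_le_mul_of_nonneg_left hi8 hu0.le
  have h100 : 1 / K ^ 100 ≤ u * (1 / 256) := by
    rw [show 1 / K ^ 100 = u * (K ^ 99)⁻¹ by
      simp only [hu]; rw [← mul_inv, ← pow_succ', one_div]]
    exact mul_le_mul_of_nonneg_left hi99 hu0.le
  have hKu : 2 / K * X t₁ 4 - 2 / K * X t₀ 4 ≤ 2 * u * (1 / 10) := by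
    have : 2 / K * X t₁ 4 - 2 / K * X t₀ 4 = 2 * u * (X t₁ 4 - X t₀ 4) := by
      simp only [hu]; ring
    rw [this]
    exact mul_le_mul_of_nonneg_left (by linarith) (by positivity)
  have hfin : 97 / 100 * (t₁ - t₀) ≤ 2 * (u * (1 / 256)) + 2 * u * (1 / 10) := by linarith
  rw [hlen] at hfin
  nlinarith

/-! ## Equipartition energy `E_*` and its decay (toke) -/

/-- Derivative of the modified energy `E_* = ½(1-ã²) - ½K·(adε²/c)·ã` (`= ½(a²+b²+c²+d²) - …` by
(energy-con)): `∂ₜE_* = -½Kã(a²+d²) - ½K·R·ã - ½K²·V·d²`, with `R` the remainder of `∂ₜV`.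
[cite: Tao2016AveragedNS, §5.5 (proof of (beable))] -/
theorem hasDerivAt_Es (hX : ∀ t, HasDerivAt X (delayCircuit K ε (X t)) t) (hε : ε ≠ 0)
    {t : ℝ} (hc : X t 2 ≠ 0) :
    HasDerivAt (fun s => (1 - X s 4 * X s 4) / 2
        - K / 2 * (X s 0 * X s 3 * (ε ^ 2 * (X s 2)⁻¹) * X s 4))
      (-(K / 2) * X t 4 * (X t 0 ^ 2 + X t 3 ^ 2)
        - K / 2 * ((-(ε * X t 0 * X t 1 * X t 3 + ε ^ 2 * exp (-K ^ 10) * X t 0 * X t 2 * X t 3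
            + K * X t 0 * X t 3 * X t 4) * (ε ^ 2 * (X t 2)⁻¹)
          - X t 0 * X t 3 * (ε ^ 2 * (X t 2)⁻¹) *
            ((ε ^ 2 * exp (-K ^ 10) * X t 0 ^ 2 + ε⁻¹ * K ^ 10 * X t 1 * X t 2) * (X t 2)⁻¹)))
          * X t 4
        - K ^ 2 / 2 * (X t 0 * X t 3 * (ε ^ 2 * (X t 2)⁻¹)) * X t 3 ^ 2) t := by
  have hEE := ((hasDerivAt_e hX t).fun_mul (hasDerivAt_e hX t)).const_sub 1 |>.div_const 2
  have hVE := ((hasDerivAt_V hX hε hc).fun_mul (hasDerivAt_e hX t)).const_mul (K / 2)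
  refine (hEE.fun_sub hVE).congr_deriv ?_
  ring

/-- The algebra of (E*-decay): with `a²+b²+c²+d²+ã² = 1`, `ã ≥ ã₀ ≥ 0`, `|R| ≤ 9K⁻⁹⁰`,
`0 ≤ q ≤ K⁻¹⁰⁰`, `b², c² ≤ 25ε²`, `ε ≤ K⁻¹⁰⁰`:
`∂ₜE_* + Kã₀E_* = ½K(a²+d²)(ã₀-ã) + ½Kã₀(b²+c²) - ½KRã - ½K²Vd² - ½K²ã₀Vã ≤ 7K⁻⁸⁹`.
[cite: Tao2016AveragedNS, §5.5 (proof of (beable))] -/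
theorem Es_alg {K ε a b c d e e₀ q R : ℝ} (hK : 16 ≤ K)
    (hsum : a ^ 2 + b ^ 2 + c ^ 2 + d ^ 2 + e ^ 2 = 1) (hq0 : 0 ≤ q) (hq1 : q ≤ 1 / K ^ 100)
    (hR : |R| ≤ 9 / K ^ 90) (ha : |a| ≤ 1) (hd : |d| ≤ 1) (he : |e| ≤ 1) (he0 : 0 ≤ e₀)
    (he01 : e₀ ≤ 1) (hee₀ : e₀ ≤ e) (hb2 : b ^ 2 ≤ (5 * ε) ^ 2) (hc2 : c ^ 2 ≤ (5 * ε) ^ 2)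
    (hε : 0 < ε) (hε1 : ε ≤ 1) (hε100 : ε ≤ 1 / K ^ 100) :
    (-(K / 2) * e * (a ^ 2 + d ^ 2) - K / 2 * R * e - K ^ 2 / 2 * (a * d * q) * d ^ 2)
      + K * e₀ * ((1 - e * e) / 2 - K / 2 * (a * d * q * e)) ≤ 7 / K ^ 89 := by
  have hK0 : 0 < K := by linarith
  have hK1 : 1 ≤ K := by linarith
  have key : (-(K / 2) * e * (a ^ 2 + d ^ 2) - K / 2 * R * e - K ^ 2 / 2 * (a * d * q) * d ^ 2)
      + K * e₀ * ((1 - e * e) / 2 - K / 2 * (a * d * q * e))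
      = K / 2 * (a ^ 2 + d ^ 2) * (e₀ - e) + K / 2 * e₀ * (b ^ 2 + c ^ 2)
        - K / 2 * R * e - K ^ 2 / 2 * (a * d * q) * d ^ 2 - K ^ 2 / 2 * e₀ * (a * d * q) * e := by
    linear_combination (-(K / 2) * e₀) * hsum
  rw [key]
  have hV : |a * d * q| ≤ 1 / K ^ 100 := by
    rw [abs_mul, abs_mul, abs_of_nonneg hq0]
    calc |a| * |d| * q ≤ 1 * 1 * (1 / K ^ 100) :=
          mul_le_mul (mul_le_mul ha hd (abs_nonneg _) zero_le_one) hq1 hq0 (by norm_num)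
      _ = 1 / K ^ 100 := by ring
  have t1 : K / 2 * (a ^ 2 + d ^ 2) * (e₀ - e) ≤ 0 := by
    have h1 : 0 ≤ K / 2 * (a ^ 2 + d ^ 2) := by positivity
    have h2 : 0 ≤ K / 2 * (a ^ 2 + d ^ 2) * (e - e₀) := mul_nonneg h1 (sub_nonneg.2 hee₀)
    have h3 : K / 2 * (a ^ 2 + d ^ 2) * (e₀ - e) = -(K / 2 * (a ^ 2 + d ^ 2) * (e - e₀)) := by
      ring
    rw [h3]; exact neg_nonpos.2 h2
  have t2 : K / 2 * e₀ * (b ^ 2 + c ^ 2) ≤ 1 / K ^ 89 := by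
    have h50 : b ^ 2 + c ^ 2 ≤ 50 * ε := by
      have : (5 * ε) ^ 2 = 25 * ε ^ 2 := by ring
      have hεε : ε ^ 2 ≤ ε := by
        calc ε ^ 2 = ε * ε := sq ε
          _ ≤ ε * 1 := mul_le_mul_of_nonneg_left hε1 hε.le
          _ = ε := mul_one ε
      linarith
    have h25 : (25 : ℝ) ≤ K ^ 10 := by
      have : (16 : ℝ) ^ 10 ≤ K ^ 10 := pow_le_pow_left₀ (by norm_num) hK 10
      linarith
    calc K / 2 * e₀ * (b ^ 2 + c ^ 2) ≤ K / 2 * 1 * (50 * (1 / K ^ 100)) :=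
          mul_le_mul (mul_le_mul_of_nonneg_left he01 (by positivity))
            (h50.trans (by linarith)) (by positivity) (by positivity)
      _ = 25 / (K ^ 10 * K ^ 89) := by field_simp; ring
      _ ≤ 25 / (25 * K ^ 89) := by
          apply div_le_div_of_nonneg_left (by norm_num) (by positivity)
          exact mul_le_mul_of_nonneg_right h25 (by positivity)
      _ = 1 / K ^ 89 := by field_simp
  have t3 : -(K / 2 * R * e) ≤ 9 / 2 / K ^ 89 := by
    have : |K / 2 * R * e| ≤ K / 2 * (9 / K ^ 90) * 1 := by
      rw [abs_mul, abs_mul, abs_of_pos (by positivity : 0 < K / 2)]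
      exact mul_le_mul (mul_le_mul_of_nonneg_left hR (by positivity)) he (abs_nonneg _)
        (by positivity)
    have h' := (abs_le.1 this).1
    have : K / 2 * (9 / K ^ 90) * 1 = 9 / 2 / K ^ 89 := by field_simp
    linarith
  have t4 : -(K ^ 2 / 2 * (a * d * q) * d ^ 2) ≤ 1 / 2 / K ^ 98 := by
    have hd2 : d ^ 2 ≤ 1 := by
      have := pow_le_pow_left₀ (abs_nonneg d) hd 2
      rwa [sq_abs, one_pow] at this
    have : |K ^ 2 / 2 * (a * d * q) * d ^ 2| ≤ K ^ 2 / 2 * (1 / K ^ 100) * 1 := by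
      rw [abs_mul, abs_mul, abs_of_pos (by positivity : 0 < K ^ 2 / 2),
        abs_of_nonneg (sq_nonneg d)]
      exact mul_le_mul (mul_le_mul_of_nonneg_left hV (by positivity)) hd2 (sq_nonneg _)
        (by positivity)
    have h' := (abs_le.1 this).1
    have : K ^ 2 / 2 * (1 / K ^ 100) * 1 = 1 / 2 / K ^ 98 := by field_simp
    linarith
  have t5 : -(K ^ 2 / 2 * e₀ * (a * d * q) * e) ≤ 1 / 2 / K ^ 98 := by
    have : |K ^ 2 / 2 * e₀ * (a * d * q) * e| ≤ K ^ 2 / 2 * 1 * (1 / K ^ 100) * 1 := by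
      rw [abs_mul, abs_mul, abs_mul, abs_of_pos (by positivity : 0 < K ^ 2 / 2),
        abs_of_nonneg he0]
      exact mul_le_mul (mul_le_mul (mul_le_mul_of_nonneg_left he01 (by positivity)) hV
        (abs_nonneg _) (by positivity)) he (abs_nonneg _) (by positivity)
    have h' := (abs_le.1 this).1
    have : K ^ 2 / 2 * 1 * (1 / K ^ 100) * 1 = 1 / 2 / K ^ 98 := by field_simp
    linarith
  have h98 : 1 / 2 / K ^ 98 ≤ 1 / 2 / K ^ 89 := by
    apply div_le_div_of_nonneg_left (by norm_num) (by positivity)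
    exact pow_le_pow_right₀ hK1 (by norm_num)
  have hsum7 : 1 / K ^ 89 + 9 / 2 / K ^ 89 + 1 / 2 / K ^ 89 + 1 / 2 / K ^ 89 ≤ 7 / K ^ 89 := by
    rw [show 1 / K ^ 89 + 9 / 2 / K ^ 89 + 1 / 2 / K ^ 89 + 1 / 2 / K ^ 89 = (13 / 2) / K ^ 89 by
      ring]
    exact div_le_div_of_nonneg_right (by norm_num) (by positivity)
  linarith

/-- Dissipation inequality for `E_*` on `[t', 2]`, `t' = t_c + 1/K`:
`∂ₜE_* + Kã(t')E_* ≤ 7K⁻⁸⁹`. [cite: Tao2016AveragedNS, §5.5 (proof of (beable))] -/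
theorem Es_dissipation (hX : ∀ t, HasDerivAt X (delayCircuit K ε (X t)) t) (h0 : X 0 = delayInit)
    (hε : 0 < ε) (hε1 : ε ≤ 1) (hK : 16 ≤ K) (hεK : ε ^ 2 ≤ 1 / (6 * K ^ 20))
    (hε100 : ε ≤ 1 / K ^ 100)
    (hεexp : ε ^ 2 ≤ exp (-(18 * K ^ 10)) / (64 * K ^ 10)) (hN3 : K ^ 110 ≤ exp (K / 8))
    (hτ1 : 1 ≤ τ) (hτ74 : τ < 7 / 4)
    (hcτ : ∀ t, 0 ≤ t → t ≤ τ → X t 2 ≤ ε ^ 2 / K ^ 10) (hcτeq : X τ 2 = ε ^ 2 / K ^ 10)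
    {s : ℝ} (hs : s ∈ Icc (τ + K⁻¹) 2) :
    (-(K / 2) * X s 4 * (X s 0 ^ 2 + X s 3 ^ 2)
        - K / 2 * ((-(ε * X s 0 * X s 1 * X s 3 + ε ^ 2 * exp (-K ^ 10) * X s 0 * X s 2 * X s 3
            + K * X s 0 * X s 3 * X s 4) * (ε ^ 2 * (X s 2)⁻¹)
          - X s 0 * X s 3 * (ε ^ 2 * (X s 2)⁻¹) *
            ((ε ^ 2 * exp (-K ^ 10) * X s 0 ^ 2 + ε⁻¹ * K ^ 10 * X s 1 * X s 2) * (X s 2)⁻¹)))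
          * X s 4
        - K ^ 2 / 2 * (X s 0 * X s 3 * (ε ^ 2 * (X s 2)⁻¹)) * X s 3 ^ 2)
      + K * X (τ + K⁻¹) 4 * ((1 - X s 4 * X s 4) / 2
        - K / 2 * (X s 0 * X s 3 * (ε ^ 2 * (X s 2)⁻¹) * X s 4)) ≤ 7 / K ^ 89 := by
  have hK0 : 0 < K := by linarith
  have hK1 : 1 ≤ K := by linarith
  have hτ2 : τ ≤ 2 := by linarith
  have hK9 : (K ^ 9)⁻¹ ≤ K⁻¹ := by
    rw [inv_le_inv₀ (by positivity) hK0]; exact le_self_pow₀ hK1 (by norm_num)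
  have hsI : s ∈ Icc (τ + (K ^ 9)⁻¹) 2 := ⟨by linarith [hs.1], hs.2⟩
  have hs02 : s ∈ Icc (0 : ℝ) 2 := ⟨by linarith [hs.1, inv_pos.2 hK0], hs.2⟩
  have hcl : K ^ 100 * ε ^ 2 ≤ X s 2 := c_large hX h0 hε hε1 hK hεK hεexp hN3 hτ1 hτ2 hcτ hcτeq hsI
  have hcpos : 0 < X s 2 := lt_of_lt_of_le (by positivity) hcl
  have hq0 : 0 ≤ ε ^ 2 * (X s 2)⁻¹ := by positivity
  have hq1 : ε ^ 2 * (X s 2)⁻¹ ≤ 1 / K ^ 100 := by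
    rw [← div_eq_mul_inv, div_le_div_iff₀ hcpos (by positivity), one_mul]; linarith
  obtain ⟨hb5, hc5⟩ := bc_small hX h0 hε hε1 hs02
  have hb2 : X s 1 ^ 2 ≤ (5 * ε) ^ 2 := by
    rw [← sq_abs]; exact pow_le_pow_left₀ (abs_nonneg _) hb5 2
  have hc2 : X s 2 ^ 2 ≤ (5 * ε) ^ 2 := by
    rw [← sq_abs]; exact pow_le_pow_left₀ (abs_nonneg _) hc5 2
  have hmonoE := delayCircuit_output_monotone hK0.le hX
  exact Es_alg hK (traj_sum_sq_eq_one hX h0 s) hq0 hq1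
    (V_remainder_le hX h0 hε hε1 hK hεK hεexp hN3 hτ1 hτ2 hcτ hcτeq hsI)
    (traj_abs_le_one hX h0 s 0) (traj_abs_le_one hX h0 s 3) (traj_abs_le_one hX h0 s 4)
    (e_nonneg hX h0 hK0.le (by positivity))
    ((le_abs_self _).trans (traj_abs_le_one hX h0 _ 4)) (hmonoE hs.1) hb2 hc2 hε hε1 hε100

end PhaseThree


section Decay

variable {K ε τ : ℝ} {X : ℝ → Fin 5 → ℝ}

/-- The algebra of Grönwall's conclusion: from
`E(t)e^{t} - C e^{t} ≤ E(t')e^{t'} - C e^{t'}` (`e^{t'} = e^{t}ρ`, `0 < ρ`, `C ≥ 0`, `E(t') ≤ 1`)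
conclude `E(t) ≤ ρ + C`. [folklore] -/
theorem decay_alg {E E' C A ρ : ℝ} (hA : 0 < A) (hρ0 : 0 < ρ) (hC : 0 ≤ C)
    (hE' : E' ≤ 1) (h : E * A - C * A ≤ E' * (A * ρ) - C * (A * ρ)) : E ≤ ρ + C := by
  have h1 : (E - C) * A ≤ ((E' - C) * ρ) * A := by
    have e1 : (E - C) * A = E * A - C * A := by ring
    have e2 : ((E' - C) * ρ) * A = E' * (A * ρ) - C * (A * ρ) := by ring
    rw [e1, e2]; exact h
  have h2 : E - C ≤ (E' - C) * ρ := le_of_mul_le_mul_right h1 hA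
  have h3 : (E' - C) * ρ ≤ 1 * ρ := mul_le_mul_of_nonneg_right (by linarith) hρ0.le
  linarith

/-- On `I = [t_c + K⁻⁹, 2]`: `|½K·V·ã| ≤ ½K⁻⁹⁹` (`V = adε²/c`, `ε²/c ≤ K⁻¹⁰⁰`).
[cite: Tao2016AveragedNS, §5.5 (proof of (beable))] -/
theorem KVe_small (hX : ∀ t, HasDerivAt X (delayCircuit K ε (X t)) t) (h0 : X 0 = delayInit)
    (hε : 0 < ε) (hε1 : ε ≤ 1) (hK : 16 ≤ K) (hεK : ε ^ 2 ≤ 1 / (6 * K ^ 20))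
    (hεexp : ε ^ 2 ≤ exp (-(18 * K ^ 10)) / (64 * K ^ 10)) (hN3 : K ^ 110 ≤ exp (K / 8))
    (hτ1 : 1 ≤ τ) (hτ2 : τ ≤ 2)
    (hcτ : ∀ t, 0 ≤ t → t ≤ τ → X t 2 ≤ ε ^ 2 / K ^ 10) (hcτeq : X τ 2 = ε ^ 2 / K ^ 10)
    {s : ℝ} (hs : s ∈ Icc (τ + (K ^ 9)⁻¹) 2) :
    |K / 2 * (X s 0 * X s 3 * (ε ^ 2 * (X s 2)⁻¹) * X s 4)| ≤ 1 / 2 / K ^ 99 := by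
  have hK0 : 0 < K := by linarith
  have hcl : K ^ 100 * ε ^ 2 ≤ X s 2 :=
    c_large hX h0 hε hε1 hK hεK hεexp hN3 hτ1 hτ2 hcτ hcτeq hs
  have hcpos : 0 < X s 2 := lt_of_lt_of_le (by positivity) hcl
  have hq0 : 0 ≤ ε ^ 2 * (X s 2)⁻¹ := by positivity
  have hq : ε ^ 2 * (X s 2)⁻¹ ≤ 1 / K ^ 100 := by
    rw [← div_eq_mul_inv, div_le_div_iff₀ hcpos (by positivity), one_mul]; linarith
  rw [abs_mul, abs_of_pos (by positivity : 0 < K / 2), abs_mul, abs_mul, abs_mul,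
    abs_of_nonneg hq0]
  calc K / 2 * (|X s 0| * |X s 3| * (ε ^ 2 * (X s 2)⁻¹) * |X s 4|)
      ≤ K / 2 * (1 * 1 * (1 / K ^ 100) * 1) := by
        refine mul_le_mul_of_nonneg_left ?_ (by positivity)
        exact mul_le_mul (mul_le_mul (mul_le_mul (traj_abs_le_one hX h0 s 0)
          (traj_abs_le_one hX h0 s 3) (abs_nonneg _) zero_le_one) hq hq0 (by norm_num))
          (traj_abs_le_one hX h0 s 4) (abs_nonneg _) (by positivity)
    _ = 1 / 2 / K ^ 99 := by field_simp

/-- **(toke)**: on `[t_c + 1/√K, 2]`,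
`E_*(t) ≤ e^{-Kã(t')(t-t')} + 7K⁻⁸⁹/(Kã(t')) ≤ e^{(1-√K)/10} + 70K⁻⁹⁰` (Grönwall from
`t' = t_c + 1/K`, `ã(t') ≥ 1/10`). [cite: Tao2016AveragedNS, §5.5 (toke)] -/
theorem Es_decay (hX : ∀ t, HasDerivAt X (delayCircuit K ε (X t)) t) (h0 : X 0 = delayInit)
    (hε : 0 < ε) (hε1 : ε ≤ 1) (hK : 16 ≤ K) (hεK : ε ^ 2 ≤ 1 / (6 * K ^ 20))
    (hε100 : ε ≤ 1 / K ^ 100)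
    (hεexp : ε ^ 2 ≤ exp (-(18 * K ^ 10)) / (64 * K ^ 10)) (hN3 : K ^ 110 ≤ exp (K / 8))
    (hτ1 : 1 ≤ τ) (hτ74 : τ < 7 / 4)
    (hcτ : ∀ t, 0 ≤ t → t ≤ τ → X t 2 ≤ ε ^ 2 / K ^ 10) (hcτeq : X τ 2 = ε ^ 2 / K ^ 10)
    {t : ℝ} (ht : t ∈ Icc (τ + 1 / sqrt K) 2) :
    (1 - X t 4 * X t 4) / 2 - K / 2 * (X t 0 * X t 3 * (ε ^ 2 * (X t 2)⁻¹) * X t 4)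
      ≤ exp ((1 - sqrt K) / 10) + 70 / K ^ 90 := by
  have hK0 : 0 < K := by linarith
  have hK1 : 1 ≤ K := by linarith
  have hτ2 : τ ≤ 2 := by linarith
  obtain ⟨hs0, hs4, hKs, h4, hKs2⟩ := invSqrt_facts hK
  have he₀ : 1 / 10 ≤ X (τ + K⁻¹) 4 := e_tenth hX h0 hε hε1 hK hεK hεexp hN3 hτ1 hτ74 hcτ hcτeq
  have he₀pos : 0 < X (τ + K⁻¹) 4 := lt_of_lt_of_le (by norm_num) he₀
  have hKe : 0 < K * X (τ + K⁻¹) 4 := mul_pos hK0 he₀pos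
  have hK9 : (K ^ 9)⁻¹ ≤ K⁻¹ := by
    rw [inv_le_inv₀ (by positivity) hK0]; exact le_self_pow₀ hK1 (by norm_num)
  have hKinv : K⁻¹ ≤ (sqrt K)⁻¹ := by
    rw [inv_le_inv₀ hK0 (by positivity)]
    calc sqrt K ≤ sqrt K * sqrt K := le_mul_of_one_le_right (by positivity) (by linarith)
      _ = K := mul_self_sqrt hK0.le
  have ht't : τ + K⁻¹ ≤ t := by rw [one_div] at ht; linarith [ht.1]
  have hI : ∀ s ∈ Icc (τ + K⁻¹) 2, s ∈ Icc (τ + (K ^ 9)⁻¹) 2 := fun s hs =>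
    ⟨by linarith [hs.1], hs.2⟩
  have hC0 : 0 ≤ 7 / K ^ 89 / (K * X (τ + K⁻¹) 4) := by positivity
  -- Grönwall in integrating-factor form
  have hanti := antitoneOn_intFactor (s := Icc (τ + K⁻¹) 2)
    (f := fun s => (1 - X s 4 * X s 4) / 2 - K / 2 * (X s 0 * X s 3 * (ε ^ 2 * (X s 2)⁻¹) * X s 4))
    (g := fun _ => -(K * X (τ + K⁻¹) 4)) (G := fun s => -(K * X (τ + K⁻¹) 4 * s))
    (φ := fun s => 7 / K ^ 89 * exp (K * X (τ + K⁻¹) 4 * s))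
    (Φ := fun s => 7 / K ^ 89 / (K * X (τ + K⁻¹) 4) * exp (K * X (τ + K⁻¹) 4 * s))
    (convex_Icc _ 2)
    (fun s hs => by
      have hsI := hI s hs
      have hcl : K ^ 100 * ε ^ 2 ≤ X s 2 :=
        c_large hX h0 hε hε1 hK hεK hεexp hN3 hτ1 hτ2 hcτ hcτeq hsI
      have hcne : X s 2 ≠ 0 := (lt_of_lt_of_le (by positivity) hcl).ne'
      exact hasDerivAt_Es hX hε.ne' hcne)
    (fun s _ => ((hasDerivAt_id s).const_mul (K * X (τ + K⁻¹) 4)).neg.congr_deriv (by simp))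
    (fun s _ => by
      have hne : K * X (τ + K⁻¹) 4 ≠ 0 := hKe.ne'
      have := (((hasDerivAt_id s).const_mul (K * X (τ + K⁻¹) 4)).exp).const_mul
        (7 / K ^ 89 / (K * X (τ + K⁻¹) 4))
      refine this.congr_deriv ?_
      simp only [mul_one, id_eq]
      generalize X (τ + K⁻¹) 4 = e₀ at hne ⊢
      have hne' : e₀ ≠ 0 := right_ne_zero_of_mul hne
      field_simp)
    (fun s hs => by
      have hdis := Es_dissipation hX h0 hε hε1 hK hεK hε100 hεexp hN3 hτ1 hτ74 hcτ hcτeq hs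
      have hE : exp (-(-(K * X (τ + K⁻¹) 4 * s))) = exp (K * X (τ + K⁻¹) 4 * s) := by
        rw [neg_neg]
      rw [hE]
      have h2 := mul_le_mul_of_nonneg_right hdis (exp_pos (K * X (τ + K⁻¹) 4 * s)).le
      linarith)
  have ht'mem : τ + K⁻¹ ∈ Icc (τ + K⁻¹) 2 :=
    ⟨le_rfl, by linarith [inv_le_one_of_one_le₀ hK1]⟩
  have htmem : t ∈ Icc (τ + K⁻¹) 2 := ⟨ht't, ht.2⟩
  have hA := hanti ht'mem htmem ht't
  simp only [neg_neg] at hA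
  have hsplit : exp (K * X (τ + K⁻¹) 4 * (τ + K⁻¹))
      = exp (K * X (τ + K⁻¹) 4 * t) * exp (K * X (τ + K⁻¹) 4 * ((τ + K⁻¹) - t)) := by
    rw [← exp_add]; congr 1; ring
  rw [hsplit] at hA
  -- `E_*(t') ≤ 1`
  have hEs1 : (1 - X (τ + K⁻¹) 4 * X (τ + K⁻¹) 4) / 2
      - K / 2 * (X (τ + K⁻¹) 0 * X (τ + K⁻¹) 3 * (ε ^ 2 * (X (τ + K⁻¹) 2)⁻¹) * X (τ + K⁻¹) 4)
      ≤ 1 := by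
    have h1 : (1 - X (τ + K⁻¹) 4 * X (τ + K⁻¹) 4) / 2 ≤ 1 / 2 := by
      nlinarith [mul_self_nonneg (X (τ + K⁻¹) 4)]
    have h2 := (abs_le.1 (KVe_small hX h0 hε hε1 hK hεK hεexp hN3 hτ1 hτ2 hcτ hcτeq
      (hI _ ht'mem))).1
    have h3 : 1 / 2 / K ^ 99 ≤ 1 / 2 := by
      rw [div_le_iff₀ (by positivity)]
      have : (1 : ℝ) ≤ K ^ 99 := one_le_pow₀ hK1
      linarith
    linarith
  have hρ0 : 0 < exp (K * X (τ + K⁻¹) 4 * ((τ + K⁻¹) - t)) := exp_pos _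
  have hEst := decay_alg (exp_pos _) hρ0 hC0 hEs1 hA
  -- `ρ ≤ exp((1 - √K)/10)`
  have hρle : exp (K * X (τ + K⁻¹) 4 * ((τ + K⁻¹) - t)) ≤ exp ((1 - sqrt K) / 10) := by
    rw [exp_le_exp]
    have h1 : K * X (τ + K⁻¹) 4 * ((τ + K⁻¹) - t) ≤ K * (1 / 10) * ((τ + K⁻¹) - t) := by
      have hn : (τ + K⁻¹) - t ≤ 0 := by linarith
      have := mul_le_mul_of_nonpos_right (mul_le_mul_of_nonneg_left he₀ hK0.le) hn
      linarith
    have h2 : K * (1 / 10) * ((τ + K⁻¹) - t) ≤ K * (1 / 10) * (K⁻¹ - (sqrt K)⁻¹) := by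
      refine mul_le_mul_of_nonneg_left ?_ (by positivity)
      rw [one_div] at ht; linarith [ht.1]
    have h3 : K * (1 / 10) * (K⁻¹ - (sqrt K)⁻¹) = (1 - sqrt K) / 10 := by
      have : K * (sqrt K)⁻¹ = sqrt K := hKs
      have hKK : K * K⁻¹ = 1 := mul_inv_cancel₀ hK0.ne'
      calc K * (1 / 10) * (K⁻¹ - (sqrt K)⁻¹) = (K * K⁻¹ - K * (sqrt K)⁻¹) / 10 := by ring
        _ = (1 - sqrt K) / 10 := by rw [this, hKK]
    linarith
  have hCle : 7 / K ^ 89 / (K * X (τ + K⁻¹) 4) ≤ 70 / K ^ 90 := by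
    rw [div_le_div_iff₀ hKe (by positivity)]
    calc 7 / K ^ 89 * K ^ 90 = 7 * K := by field_simp
      _ = 70 * (K * (1 / 10)) := by ring
      _ ≤ 70 * (K * X (τ + K⁻¹) 4) := by
          have := mul_le_mul_of_nonneg_left he₀ hK0.le
          linarith
  linarith

/-- **(toke) ⇒ (beable), core estimate**: on `[t_c + 1/√K, 2]`, `a² + d² ≤ 142K⁻²⁰`
(`a² + d² = 2E_* + KVã - b² - c²`). [cite: Tao2016AveragedNS, §5.5 (beable)] -/
theorem ad_small_late (hX : ∀ t, HasDerivAt X (delayCircuit K ε (X t)) t) (h0 : X 0 = delayInit)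
    (hε : 0 < ε) (hε1 : ε ≤ 1) (hK : 16 ≤ K) (hεK : ε ^ 2 ≤ 1 / (6 * K ^ 20))
    (hε100 : ε ≤ 1 / K ^ 100)
    (hεexp : ε ^ 2 ≤ exp (-(18 * K ^ 10)) / (64 * K ^ 10)) (hN3 : K ^ 110 ≤ exp (K / 8))
    (hN4 : 2 * exp ((1 - sqrt K) / 10) ≤ 1 / K ^ 20)
    (hτ1 : 1 ≤ τ) (hτ74 : τ < 7 / 4)
    (hcτ : ∀ t, 0 ≤ t → t ≤ τ → X t 2 ≤ ε ^ 2 / K ^ 10) (hcτeq : X τ 2 = ε ^ 2 / K ^ 10)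
    {t : ℝ} (ht : t ∈ Icc (τ + 1 / sqrt K) 2) : X t 0 ^ 2 + X t 3 ^ 2 ≤ 142 / K ^ 20 := by
  have hK0 : 0 < K := by linarith
  have hK1 : 1 ≤ K := by linarith
  have hτ2 : τ ≤ 2 := by linarith
  obtain ⟨hs0, hs4, hKs, h4, hKs2⟩ := invSqrt_facts hK
  have hKinv : K⁻¹ ≤ (sqrt K)⁻¹ := by
    rw [inv_le_inv₀ hK0 (by positivity)]
    calc sqrt K ≤ sqrt K * sqrt K := le_mul_of_one_le_right (by positivity) (by linarith)
      _ = K := mul_self_sqrt hK0.le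
  have hK9 : (K ^ 9)⁻¹ ≤ K⁻¹ := by
    rw [inv_le_inv₀ (by positivity) hK0]; exact le_self_pow₀ hK1 (by norm_num)
  have htI : t ∈ Icc (τ + (K ^ 9)⁻¹) 2 := ⟨by rw [one_div] at ht; linarith [ht.1], ht.2⟩
  have hEs := Es_decay hX h0 hε hε1 hK hεK hε100 hεexp hN3 hτ1 hτ74 hcτ hcτeq ht
  have hVt := (abs_le.1 (KVe_small hX h0 hε hε1 hK hεK hεexp hN3 hτ1 hτ2 hcτ hcτeq htI)).2
  have hsum := traj_sum_sq_eq_one hX h0 t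
  have h99 : 1 / 2 / K ^ 99 ≤ 1 / 2 / K ^ 20 := by
    apply div_le_div_of_nonneg_left (by norm_num) (by positivity)
    exact pow_le_pow_right₀ hK1 (by norm_num)
  have h90 : 70 / K ^ 90 ≤ 70 / K ^ 20 := by
    apply div_le_div_of_nonneg_left (by norm_num) (by positivity)
    exact pow_le_pow_right₀ hK1 (by norm_num)
  have hexp20 : exp ((1 - sqrt K) / 10) ≤ 1 / 2 / K ^ 20 := by
    have h := hN4
    rw [div_div, le_div_iff₀ (by positivity)]
    rw [le_div_iff₀ (by positivity)] at h
    linarith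
  -- express everything in the single atom `w = (K²⁰)⁻¹`
  have hw1 : (1 : ℝ) / 2 / K ^ 20 = 1 / 2 * (K ^ 20)⁻¹ := by ring
  have hw2 : (70 : ℝ) / K ^ 20 = 70 * (K ^ 20)⁻¹ := by ring
  have hw3 : (142 : ℝ) / K ^ 20 = 142 * (K ^ 20)⁻¹ := by ring
  rw [hw3]
  rw [hw1] at hexp20 h99
  rw [hw2] at h90
  have hee : X t 4 * X t 4 = X t 4 ^ 2 := by ring
  linarith [sq_nonneg (X t 1), sq_nonneg (X t 2)]

/-- **(beable), squared form**: for `t ≥ t_c + 1/√K`, `a² + b² + c² + d² ≤ 143K⁻²⁰` (on `[·,2]` from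
`ad_small_late` and `b, c = O(ε)`; for `t ≥ 2` by monotonicity of `ã` and (energy-con)).
[cite: Tao2016AveragedNS, §5.5 (beable)] -/
theorem late_sum_sq (hX : ∀ t, HasDerivAt X (delayCircuit K ε (X t)) t) (h0 : X 0 = delayInit)
    (hε : 0 < ε) (hε1 : ε ≤ 1) (hK : 16 ≤ K) (hεK : ε ^ 2 ≤ 1 / (6 * K ^ 20))
    (hε100 : ε ≤ 1 / K ^ 100)
    (hεexp : ε ^ 2 ≤ exp (-(18 * K ^ 10)) / (64 * K ^ 10)) (hN3 : K ^ 110 ≤ exp (K / 8))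
    (hN4 : 2 * exp ((1 - sqrt K) / 10) ≤ 1 / K ^ 20)
    (hτ1 : 1 ≤ τ) (hτ74 : τ < 7 / 4)
    (hcτ : ∀ t, 0 ≤ t → t ≤ τ → X t 2 ≤ ε ^ 2 / K ^ 10) (hcτeq : X τ 2 = ε ^ 2 / K ^ 10)
    {t : ℝ} (ht : τ + 1 / sqrt K ≤ t) :
    X t 0 ^ 2 + X t 1 ^ 2 + X t 2 ^ 2 + X t 3 ^ 2 ≤ 143 / K ^ 20 := by
  have hK0 : 0 < K := by linarith
  have hK1 : 1 ≤ K := by linarith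
  obtain ⟨hs0, hs4, hKs, h4, hKs2⟩ := invSqrt_facts hK
  -- `b² + c² ≤ K⁻²⁰` on `[0,2]`
  have hbc : ∀ s ∈ Icc (0 : ℝ) 2, X s 1 ^ 2 + X s 2 ^ 2 ≤ 1 / K ^ 20 := by
    intro s hs
    obtain ⟨hb5, hc5⟩ := bc_small hX h0 hε hε1 hs
    have hb2 : X s 1 ^ 2 ≤ (5 * ε) ^ 2 := by
      rw [← sq_abs]; exact pow_le_pow_left₀ (abs_nonneg _) hb5 2
    have hc2 : X s 2 ^ 2 ≤ (5 * ε) ^ 2 := by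
      rw [← sq_abs]; exact pow_le_pow_left₀ (abs_nonneg _) hc5 2
    have hεε : ε ^ 2 ≤ ε := by
      calc ε ^ 2 = ε * ε := sq ε
        _ ≤ ε * 1 := mul_le_mul_of_nonneg_left hε1 hε.le
        _ = ε := mul_one ε
    have h50 : 50 * (1 / K ^ 100) ≤ 1 / K ^ 20 := by
      rw [mul_one_div, div_le_div_iff₀ (by positivity) (by positivity), one_mul]
      have h80 : (50 : ℝ) ≤ K ^ 80 := by
        have : (16 : ℝ) ^ 80 ≤ K ^ 80 := pow_le_pow_left₀ (by norm_num) hK 80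
        linarith
      calc (50 : ℝ) * K ^ 20 ≤ K ^ 80 * K ^ 20 := mul_le_mul_of_nonneg_right h80 (by positivity)
        _ = K ^ 100 := by ring
    have : (5 * ε) ^ 2 = 25 * ε ^ 2 := by ring
    linarith [hεε.trans hε100]
  have hle2 : ∀ s, τ + 1 / sqrt K ≤ s → s ≤ 2 →
      X s 0 ^ 2 + X s 1 ^ 2 + X s 2 ^ 2 + X s 3 ^ 2 ≤ 143 / K ^ 20 := by
    intro s hs1 hs2
    have had := ad_small_late hX h0 hε hε1 hK hεK hε100 hεexp hN3 hN4 hτ1 hτ74 hcτ hcτeq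
      ⟨hs1, hs2⟩
    have hs0 : 0 ≤ s := by rw [one_div] at hs1; linarith
    have := hbc s ⟨hs0, hs2⟩
    have : 142 / K ^ 20 + 1 / K ^ 20 = 143 / K ^ 20 := by ring
    linarith
  by_cases h2 : t ≤ 2
  · exact hle2 t ht h2
  · -- `t > 2`: monotonicity of `ã` from time `2`
    have h2' : 2 < t := not_le.1 h2
    have hτs : τ + 1 / sqrt K ≤ 2 := by rw [one_div]; linarith
    have hS2 := hle2 2 hτs le_rfl
    have hsum2 := traj_sum_sq_eq_one hX h0 2
    have hsumt := traj_sum_sq_eq_one hX h0 t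
    have hmonoE := delayCircuit_output_monotone hK0.le hX
    have he2t : X 2 4 ≤ X t 4 := hmonoE h2'.le
    have he20 : 0 ≤ X 2 4 := e_nonneg hX h0 hK0.le (by norm_num)
    have hsq : X 2 4 ^ 2 ≤ X t 4 ^ 2 := pow_le_pow_left₀ he20 he2t 2
    linarith

/-- From `∑_{i≠4} Xᵢ² ≤ 143K⁻²⁰` and (energy-con): all of (beable) with constant `200`.
[cite: Tao2016AveragedNS, §5.5 (beable)] -/
theorem beable_of_sum_sq (hX : ∀ t, HasDerivAt X (delayCircuit K ε (X t)) t)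
    (h0 : X 0 = delayInit) (hK : 16 ≤ K) {t : ℝ} (ht0 : 0 ≤ t)
    (hS : X t 0 ^ 2 + X t 1 ^ 2 + X t 2 ^ 2 + X t 3 ^ 2 ≤ 143 / K ^ 20) :
    |X t 4 - 1| ≤ 200 / K ^ 10 ∧ ∀ i : Fin 5, i ≠ 4 → |X t i| ≤ 200 / K ^ 10 := by
  have hK0 : 0 < K := by linarith
  have hK1 : 1 ≤ K := by linarith
  have hsum := traj_sum_sq_eq_one hX h0 t
  have he0 : 0 ≤ X t 4 := e_nonneg hX h0 hK0.le ht0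
  have he1 : X t 4 ≤ 1 := (le_abs_self _).trans (traj_abs_le_one hX h0 t 4)
  have h2010 : 143 / K ^ 20 ≤ 143 / K ^ 10 := by
    apply div_le_div_of_nonneg_left (by norm_num) (by positivity)
    exact pow_le_pow_right₀ hK1 (by norm_num)
  have h143 : 143 / K ^ 10 ≤ 200 / K ^ 10 :=
    div_le_div_of_nonneg_right (by norm_num) (by positivity)
  have hsq : ∀ x : ℝ, x ^ 2 ≤ 143 / K ^ 20 → |x| ≤ 200 / K ^ 10 := by
    intro x hx
    have hx' : x ^ 2 ≤ (12 / K ^ 10) ^ 2 := by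
      rw [div_pow, show (K ^ 10) ^ 2 = K ^ 20 by ring]
      exact hx.trans (div_le_div_of_nonneg_right (by norm_num) (by positivity))
    calc |x| ≤ sqrt ((12 / K ^ 10) ^ 2) := abs_le_sqrt hx'
      _ = 12 / K ^ 10 := sqrt_sq (by positivity)
      _ ≤ 200 / K ^ 10 := div_le_div_of_nonneg_right (by norm_num) (by positivity)
  have hx0 : X t 0 ^ 2 ≤ 143 / K ^ 20 := by
    nlinarith [sq_nonneg (X t 1), sq_nonneg (X t 2), sq_nonneg (X t 3)]
  have hx1 : X t 1 ^ 2 ≤ 143 / K ^ 20 := by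
    nlinarith [sq_nonneg (X t 0), sq_nonneg (X t 2), sq_nonneg (X t 3)]
  have hx2 : X t 2 ^ 2 ≤ 143 / K ^ 20 := by
    nlinarith [sq_nonneg (X t 0), sq_nonneg (X t 1), sq_nonneg (X t 3)]
  have hx3 : X t 3 ^ 2 ≤ 143 / K ^ 20 := by
    nlinarith [sq_nonneg (X t 0), sq_nonneg (X t 1), sq_nonneg (X t 2)]
  have ha := hsq _ hx0
  have hb := hsq _ hx1
  have hc := hsq _ hx2
  have hd := hsq _ hx3
  refine ⟨?_, ?_⟩
  · rw [abs_sub_comm, abs_of_nonneg (by linarith)]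
    have : 1 - X t 4 ≤ 1 - X t 4 ^ 2 := by nlinarith
    linarith
  · intro i hi
    fin_cases i
    · exact ha
    · exact hb
    · exact hc
    · exact hd
    · exact absurd rfl hi

/-- (able2) with constant `200`: on `[0, t_c]`. [cite: Tao2016AveragedNS, §5.5 (able2)] -/
theorem able_window (hX : ∀ t, HasDerivAt X (delayCircuit K ε (X t)) t) (h0 : X 0 = delayInit)
    (hε : 0 < ε) (hε1 : ε ≤ 1) (hK : 16 ≤ K) (hεK : ε ^ 2 ≤ 1 / (6 * K ^ 20))
    (hε100 : ε ≤ 1 / K ^ 100) (hτ2 : τ ≤ 2)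
    (hcτ : ∀ t, 0 ≤ t → t ≤ τ → X t 2 ≤ ε ^ 2 / K ^ 10)
    {t : ℝ} (ht : t ∈ Icc 0 τ) :
    |X t 0 - 1| ≤ 200 / K ^ 10 ∧ ∀ i : Fin 5, i ≠ 0 → |X t i| ≤ 200 / K ^ 10 := by
  have hK0 : 0 < K := by linarith
  have hK1 : 1 ≤ K := by linarith
  have ht2 : t ∈ Icc (0 : ℝ) 2 := ⟨ht.1, ht.2.trans hτ2⟩
  have ha := a_near_one hX h0 hε hε1 hK0 hτ2 hεK hcτ ht
  obtain ⟨hb, hc⟩ := bc_small hX h0 hε hε1 ht2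
  obtain ⟨hd, he⟩ := de_small hX h0 hε hK0 hτ2 hcτ ht
  have h20 : 8 / K ^ 20 ≤ 200 / K ^ 10 := by
    calc 8 / K ^ 20 ≤ 8 / K ^ 10 := by
          apply div_le_div_of_nonneg_left (by norm_num) (by positivity)
          exact pow_le_pow_right₀ hK1 (by norm_num)
      _ ≤ 200 / K ^ 10 := div_le_div_of_nonneg_right (by norm_num) (by positivity)
  have h5 : 5 * ε ≤ 200 / K ^ 10 := by
    have h1 : 1 / K ^ 100 ≤ 1 / K ^ 10 := by
      apply div_le_div_of_nonneg_left (by norm_num) (by positivity)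
      exact pow_le_pow_right₀ hK1 (by norm_num)
    have h2 : 5 * (1 / K ^ 10) ≤ 200 / K ^ 10 := by
      rw [mul_one_div]; exact div_le_div_of_nonneg_right (by norm_num) (by positivity)
    linarith
  have h3 : 3 / K ^ 10 ≤ 200 / K ^ 10 := div_le_div_of_nonneg_right (by norm_num) (by positivity)
  have hb' := hb.trans h5
  have hc' := hc.trans h5
  have hd' := hd.trans h3
  have he' := he.trans h3
  refine ⟨ha.trans h20, ?_⟩
  intro i hi
  fin_cases i
  · exact absurd rfl hi
  · exact hb'
  · exact hc'
  · exact hd'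
  · exact he'

end Decay

/-! ## Numerics: the thresholds `K₀`, `ε₁(K)` -/

/-- `e^{K/8} ≥ K¹¹⁰` once `K ≥ 8¹¹¹·111!`. [folklore] -/
theorem numeric_N3 {K : ℝ} (hK : (8 : ℝ) ^ 111 * (Nat.factorial 111 : ℝ) ≤ K) :
    K ^ 110 ≤ exp (K / 8) := by
  have hK0 : 0 < K := lt_of_lt_of_le (by positivity) hK
  have h := Real.pow_div_factorial_le_exp (x := K / 8) (hx := by positivity) (n := 111)
  refine le_trans ?_ h
  rw [le_div_iff₀ (by positivity), div_pow, le_div_iff₀ (by positivity)]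
  calc K ^ 110 * (Nat.factorial 111 : ℝ) * 8 ^ 111
      = K ^ 110 * (8 ^ 111 * (Nat.factorial 111 : ℝ)) := by ring
    _ ≤ K ^ 110 * K := mul_le_mul_of_nonneg_left hK (by positivity)
    _ = K ^ 111 := by ring

/-- `2e^{(1-√K)/10} ≤ K⁻²⁰` once `K ≥ 2·20⁴²·42!` (and `K ≥ 16`). [folklore] -/
theorem numeric_N4 {K : ℝ} (hK16 : 16 ≤ K) (hK : 2 * 20 ^ 42 * (Nat.factorial 42 : ℝ) ≤ K) :
    2 * exp ((1 - sqrt K) / 10) ≤ 1 / K ^ 20 := by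
  have hK0 : 0 < K := by linarith
  obtain ⟨hs0, hs4, hKs, h4, hKs2⟩ := invSqrt_facts hK16
  set x : ℝ := (sqrt K - 1) / 10 with hx
  have hx0 : 0 ≤ x := by simp only [hx]; linarith
  have hxK : sqrt K / 20 ≤ x := by simp only [hx]; linarith
  have h := Real.pow_div_factorial_le_exp (x := x) (hx := hx0) (n := 42)
  have hpow : (sqrt K / 20) ^ 42 ≤ x ^ 42 := pow_le_pow_left₀ (by positivity) hxK 42
  have hsq : (sqrt K) ^ 42 = K ^ 21 := by
    rw [show (42 : ℕ) = 2 * 21 from rfl, pow_mul, sq_sqrt hK0.le]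
  have hexp : K ^ 21 / (20 ^ 42 * (Nat.factorial 42 : ℝ)) ≤ exp x := by
    refine le_trans ?_ h
    calc K ^ 21 / (20 ^ 42 * (Nat.factorial 42 : ℝ))
        = (sqrt K / 20) ^ 42 / (Nat.factorial 42 : ℝ) := by rw [div_pow, hsq, div_div]
      _ ≤ x ^ 42 / (Nat.factorial 42 : ℝ) := div_le_div_of_nonneg_right hpow (by positivity)
  have hneg : (1 - sqrt K) / 10 = -x := by simp only [hx]; ring
  rw [hneg, exp_neg, ← div_eq_mul_inv, div_le_div_iff₀ (exp_pos _) (by positivity), one_mul]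
  calc 2 * K ^ 20 ≤ K ^ 21 / (20 ^ 42 * (Nat.factorial 42 : ℝ)) := by
        rw [le_div_iff₀ (by positivity)]
        calc 2 * K ^ 20 * (20 ^ 42 * (Nat.factorial 42 : ℝ))
            = K ^ 20 * (2 * 20 ^ 42 * (Nat.factorial 42 : ℝ)) := by ring
          _ ≤ K ^ 20 * K := mul_le_mul_of_nonneg_left hK (by positivity)
          _ = K ^ 21 := by ring
    _ ≤ exp x := hexp

/-- The smallness of `ε ≤ ε₁(K) = e^{-10K¹⁰}/K¹⁰⁰` in the four forms used above. [folklore] -/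
theorem eps_facts {K ε : ℝ} (hK : 16 ≤ K) (hε : 0 < ε)
    (hεle : ε ≤ exp (-(10 * K ^ 10)) / K ^ 100) :
    ε ≤ 1 ∧ ε ^ 2 ≤ 1 / (6 * K ^ 20) ∧ ε ≤ 1 / K ^ 100 ∧
      ε ^ 2 ≤ exp (-(18 * K ^ 10)) / (64 * K ^ 10) := by
  have hK0 : 0 < K := by linarith
  have hK1 : 1 ≤ K := by linarith
  have hexp1 : exp (-(10 * K ^ 10)) ≤ 1 := by
    rw [exp_le_one_iff, neg_nonpos]; positivity
  have h100 : ε ≤ 1 / K ^ 100 :=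
    hεle.trans (div_le_div_of_nonneg_right hexp1 (by positivity))
  have hK100 : (1 : ℝ) ≤ K ^ 100 := one_le_pow₀ hK1
  have h1 : ε ≤ 1 := h100.trans (by rw [div_le_iff₀ (by positivity)]; linarith)
  have hsq : ε ^ 2 ≤ (exp (-(10 * K ^ 10)) / K ^ 100) ^ 2 := pow_le_pow_left₀ hε.le hεle 2
  refine ⟨h1, ?_, h100, ?_⟩
  · have h2 : ε ^ 2 ≤ (1 / K ^ 100) ^ 2 := pow_le_pow_left₀ hε.le h100 2
    refine h2.trans ?_
    rw [div_pow, one_pow, div_le_div_iff₀ (by positivity) (by positivity), one_mul, one_mul]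
    calc 6 * K ^ 20 ≤ K ^ 180 * K ^ 20 := by
          have : (6 : ℝ) ≤ K ^ 180 := by
            have : (16 : ℝ) ^ 180 ≤ K ^ 180 := pow_le_pow_left₀ (by norm_num) hK 180
            linarith
          exact mul_le_mul_of_nonneg_right this (by positivity)
      _ = (K ^ 100) ^ 2 := by ring
  · refine hsq.trans ?_
    rw [div_pow, div_le_div_iff₀ (by positivity) (by positivity)]
    have he : exp (-(10 * K ^ 10)) ^ 2 ≤ exp (-(18 * K ^ 10)) := by
      rw [← exp_nat_mul, exp_le_exp]; push_cast; nlinarith [pow_pos hK0 10]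
    have hp : 64 * K ^ 10 ≤ (K ^ 100) ^ 2 := by
      calc 64 * K ^ 10 ≤ K ^ 190 * K ^ 10 := by
            have : (64 : ℝ) ≤ K ^ 190 := by
              have : (16 : ℝ) ^ 190 ≤ K ^ 190 := pow_le_pow_left₀ (by norm_num) hK 190
              linarith
            exact mul_le_mul_of_nonneg_right this (by positivity)
        _ = (K ^ 100) ^ 2 := by ring
    exact mul_le_mul he hp (by positivity) (exp_pos _).le

end Thm53

/-! ## Theorem 5.3 -/

open Thm53 in

/-- **Theorem 5.3 (Delayed abrupt energy transition) holds** — discharge of the named fact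
`DelayedAbruptTransition` (with `C = 200`, `K₀ = 8¹¹¹·111! + 2·20⁴²·42! + 16`,
`ε₁(K) = e^{-10K¹⁰}/K¹⁰⁰`, `t_c` = the first time `c` reaches `K⁻¹⁰ε²`).
[cite: Tao2016AveragedNS, Theorem 5.3] -/
theorem DelayedAbruptTransition_holds : DelayedAbruptTransition := by
  have hA : (0 : ℝ) ≤ (8 : ℝ) ^ 111 * (Nat.factorial 111 : ℝ) := by positivity
  have hB : (0 : ℝ) ≤ 2 * 20 ^ 42 * (Nat.factorial 42 : ℝ) := by positivity
  refine ⟨200, by norm_num,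
    (8 : ℝ) ^ 111 * (Nat.factorial 111 : ℝ) + 2 * 20 ^ 42 * (Nat.factorial 42 : ℝ) + 16,
    by linarith, ?_⟩
  intro K hK
  have hK16 : 16 ≤ K := by linarith
  have hK0 : 0 < K := by linarith
  have hN3 : K ^ 110 ≤ exp (K / 8) := numeric_N3 (by linarith)
  have hN4 : 2 * exp ((1 - sqrt K) / 10) ≤ 1 / K ^ 20 := numeric_N4 hK16 (by linarith)
  refine ⟨exp (-(10 * K ^ 10)) / K ^ 100, by positivity, ?_⟩
  intro ε hε hεle X h0 hX
  obtain ⟨hε1, hεK, hε100, hεexp⟩ := eps_facts hK16 hε hεle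
  -- the critical time: first hitting time of the level `K⁻¹⁰ε²` by `c` on `[0,2]`
  obtain ⟨τ, hτ0, hτ2, hcτ, hτeq⟩ := exists_hitTime (continuous_traj hX 2)
    (θ := ε ^ 2 / K ^ 10) (T := 2) two_pos (by rw [init_c h0]; positivity)
  obtain ⟨hearly, hlate, hτ1, hτ74, hcτeq⟩ :=
    tc_window hX h0 hε hε1 hK16 hεK hτ0 hτ2 hcτ hτeq
  obtain ⟨hs0, hs4, hKs, h4, hKs2⟩ := invSqrt_facts hK16
  refine ⟨τ, ?_, ?_, ?_⟩
  · -- (tcable)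
    have h200 : (sqrt K)⁻¹ ≤ 200 / sqrt K := by
      rw [div_eq_mul_inv]; nlinarith
    rw [abs_le]; constructor <;> linarith
  · -- (able2)
    intro t ht
    have ht' : t ∈ Icc 0 τ := ⟨ht.1, by rw [one_div] at ht; linarith [ht.2]⟩
    exact able_window hX h0 hε hε1 hK16 hεK hε100 hτ2 hcτ ht'
  · -- (beable)
    intro t ht
    have ht0 : 0 ≤ t := by rw [one_div] at ht; linarith
    exact beable_of_sum_sq hX h0 hK16 ht0
      (late_sum_sq hX h0 hε hε1 hK16 hεK hε100 hεexp hN3 hN4 hτ1 hτ74 hcτ hcτeq ht)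


/-- **Theorem 5.3 for THE trajectory** ("the solution to the above system", p. 28): for `K ≥ K₀`
and `0 < ε ≤ ε₁(K)`, the unique global trajectory `delaySolution K ε` of (5.5)/(5.6) undergoes the
delayed abrupt energy transition with an absolute constant `C` — `DelayedAbruptTransition_holds`
transported along the reduction `delayedAbruptTransition_iff_delaySolution` of
`GlobalWellposedness.lean`. [cite: Tao2016AveragedNS, Theorem 5.3] -/
theorem delaySolution_hasAbruptTransition :
    ∃ C : ℝ, 0 < C ∧ ∃ K₀ : ℝ, 0 < K₀ ∧ ∀ K : ℝ, K₀ ≤ K → ∃ ε₁ : ℝ, 0 < ε₁ ∧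
      ∀ ε : ℝ, 0 < ε → ε ≤ ε₁ → HasAbruptTransition C K (delaySolution K ε) :=
  delayedAbruptTransition_iff_delaySolution.mp DelayedAbruptTransition_holds

/-- **The internal time-scales of the transition** (proof of Theorem 5.3, pp. 29–30) for THE
trajectory `delaySolution K ε`, `K ≥ K₀`, `0 < ε ≤ ε₁(K)`: there is a critical time
`t_c ∈ [√2 - 1/√K, √2 + 1/√K]` such that (boots)/(c-bound) `c ≤ K⁻¹⁰ε²` on `[0,t_c]` with equality
at `t_c`; (c-large) the rotor is "continuously and strongly activated" — `c ≥ K¹⁰⁰ε²` — on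
`[t_c + K⁻⁹, 2]`; (atc) `ã(t_c + 1/K) ≥ 1/10`; and from `t_c + 1/√K` on the non-output energy is
`a²+b²+c²+d² ≤ 143K⁻²⁰`. These are the quantities the cell's SPEC-SHEET reads as trigger level,
rotor onset, transfer mid-point and abruptness `1/√K`. [cite: Tao2016AveragedNS, §5.5 proof of Theorem 5.3 ((boots), (c-bound), (c-large), (atc), (beable))] -/
theorem delaySolution_internal_timescales :
    ∃ K₀ : ℝ, 0 < K₀ ∧ ∀ K : ℝ, K₀ ≤ K → ∃ ε₁ : ℝ, 0 < ε₁ ∧ ∀ ε : ℝ, 0 < ε → ε ≤ ε₁ →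
      ∃ tc : ℝ, Real.sqrt 2 - 1 / Real.sqrt K ≤ tc ∧ tc ≤ Real.sqrt 2 + 1 / Real.sqrt K ∧
        (∀ t ∈ Set.Icc 0 tc, delaySolution K ε t 2 ≤ ε ^ 2 / K ^ 10) ∧
        delaySolution K ε tc 2 = ε ^ 2 / K ^ 10 ∧
        (∀ t ∈ Set.Icc (tc + 1 / K ^ 9) 2, K ^ 100 * ε ^ 2 ≤ delaySolution K ε t 2) ∧
        1 / 10 ≤ delaySolution K ε (tc + 1 / K) 4 ∧
        (∀ t, tc + 1 / Real.sqrt K ≤ t →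
          delaySolution K ε t 0 ^ 2 + delaySolution K ε t 1 ^ 2 + delaySolution K ε t 2 ^ 2
            + delaySolution K ε t 3 ^ 2 ≤ 143 / K ^ 20) := by
  have hA : (0 : ℝ) ≤ (8 : ℝ) ^ 111 * (Nat.factorial 111 : ℝ) := by positivity
  have hB : (0 : ℝ) ≤ 2 * 20 ^ 42 * (Nat.factorial 42 : ℝ) := by positivity
  refine ⟨(8 : ℝ) ^ 111 * (Nat.factorial 111 : ℝ) + 2 * 20 ^ 42 * (Nat.factorial 42 : ℝ) + 16,
    by linarith, ?_⟩
  intro K hK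
  have hK16 : 16 ≤ K := by linarith
  have hK0 : 0 < K := by linarith
  have hN3 : K ^ 110 ≤ exp (K / 8) := Thm53.numeric_N3 (by linarith)
  have hN4 : 2 * exp ((1 - sqrt K) / 10) ≤ 1 / K ^ 20 := Thm53.numeric_N4 hK16 (by linarith)
  refine ⟨exp (-(10 * K ^ 10)) / K ^ 100, by positivity, ?_⟩
  intro ε hε hεle
  obtain ⟨hε1, hεK, hε100, hεexp⟩ := Thm53.eps_facts hK16 hε hεle
  have hX := hasDerivAt_delaySolution K ε
  have h0 := delaySolution_zero K ε
  obtain ⟨τ, hτ0, hτ2, hcτ, hτeq⟩ := Thm53.exists_hitTime (Thm53.continuous_traj hX 2)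
    (θ := ε ^ 2 / K ^ 10) (T := 2) two_pos (by rw [Thm53.init_c h0]; positivity)
  obtain ⟨hearly, hlate, hτ1, hτ74, hcτeq⟩ :=
    Thm53.tc_window hX h0 hε hε1 hK16 hεK hτ0 hτ2 hcτ hτeq
  refine ⟨τ, by rw [one_div]; exact hearly, by rw [one_div]; exact hlate,
    fun t ht => hcτ t ht.1 ht.2, hcτeq, ?_, ?_, ?_⟩
  · intro t ht
    rw [one_div] at ht
    exact Thm53.c_large hX h0 hε hε1 hK16 hεK hεexp hN3 hτ1 hτ2 hcτ hcτeq ht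
  · rw [one_div K]
    exact Thm53.e_tenth hX h0 hε hε1 hK16 hεK hεexp hN3 hτ1 hτ74 hcτ hcτeq
  · intro t ht
    exact Thm53.late_sum_sq hX h0 hε hε1 hK16 hεK hε100 hεexp hN3 hN4 hτ1 hτ74 hcτ hcτeq ht

end Literature.Analysis.FluidPDE.Tao2016AveragedNS
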